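import Summits.QuantumFields.YangMills.Theorems.BalabanUVNodesN06Proj349AtPinsPhysRC
import Literature.MathematicalPhysics.QuantumFieldTheory.Balaban1983to89.B9Ineq349SiteThresholdRateNamed
import Literature.MathematicalPhysics.QuantumFieldTheory.Balaban1983to89.B9Thm313WholeDvHolderAtPinsGraded
import Literature.MathematicalPhysics.QuantumFieldTheory.Balaban1983to89.B9RowSum261DefiniteFaces
import Literature.MathematicalPhysics.QuantumFieldTheory.Balaban1983to89.B9WalkLettersCoordsS
import Literature.MathematicalPhysics.QuantumFieldTheory.Balaban1983to89.B9GeoNbrCountBlocksY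
import Literature.MathematicalPhysics.QuantumFieldTheory.Balaban1983to89.B7Prop5WindowNumerics
import Literature.MathematicalPhysics.QuantumFieldTheory.Balaban1983to89.B7Prop3Flat
import Literature.MathematicalPhysics.QuantumFieldTheory.Balaban1983to89.B9SmoothHolderClassPProducers
import Literature.MathematicalPhysics.QuantumFieldTheory.Balaban1983to89.B9Eq340TaxiContourLocalityY
import Summits.QuantumFields.YangMills.Theorems.BalabanUVNodesN06KnitClusterWindowKE6X

/-!
# «ZK₆» (dag-n06-d g32) = «ZK₅» (✓p821988) + ONE ∀-parameter `M17 : ℝ` and ONE fact `M17 ≤ q.M₁` — the A6 witness row of «KESC-AG»'s ∕ «KE₁₃X-A»'s new x-free numeric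
# `hM17q : knitRow17M₁ N θ.toStage3Params Mstar ≤ q.M₁` (Thm 3.11's member threshold under the rows-19 scale guard; read at `M17 := knitRow17M₁ …`, any real); witness
# `p.M₁ := max 1 (max MMx (max MRc M17))` (one `max` deeper; the two proof terms reading `MRc ≤ p.M₁` re-chained). Everything else = ZK₅ VERBATIM (diff oracle: the tree file). ZK₅'s module text follows.
#
# «ZK₅» (dag-n06-d g31) = «ZK₄» (✓p813815) + FIVE facts `3 ≤ q.ρ`, `W ≤ q.Nc`, `W ≤ q.N'`, `L² ≤ q.Cℓ`, `Kc₀ ≤ q.Kc` — the A6 witness rows of the W-b edition «KESC-A»'s new x-free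
# thresholds `hρ3A hNcA hN'A hCℓA hKcA` of the rows-19 bond-sector walk-letter record `ops310WalkYO` (twins of the site record's `hρ3 hNc hN' hCℓ hKc`, read at the SAME universally
# quantified `W` (≥ `walkCntY`) and `Kc₀` (≥ `KcWalkY`)); witness unchanged (`q := pp = p`, `pp.ρ = 3`, `pp.Nc = pp.N' = W`, `pp.Cℓ = L²`, `pp.Kc = Kc₀` — five `le_rfl`). «KESC-A»'s other
# x-free binders are «KESC»'s = «KE₉X»'s (ref-A VERDICT-49), covered by «ZK₄» verbatim; its `hcntFA` (count of the generic factor localisations `SFA`) is a hypothesis on DATA, not x-free.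
# Everything else = ZK₄ VERBATIM (diff oracle: the tree file). ZK₄'s module text follows.
#
# «ZK₄» (dag-n06-d g29) = «ZK₃» (✓p813173) + THREE ∀-parameters `a48 B48 d48 > 0` and THREE facts `c35Y·a39 ≤ c·a48`, `B48 ≤ B39`, `δ39 ≤ d48` — the A6 witness rows of
# «KE₉X»'s rows-15∕16 comparison numerics against dag-n06-j's named (3.48) constants (read at `a48 := knit348a₁ …`, `B48 := knit348B₀ …`, `d48 := knit348δ₀ …`); witness
# `a39 := min 1 (c·a48∕c35Y)`, `B39 := max 1 B48` (the CP row's closed form carries `max 1 B48`), `s := min 1 (min δ₄ (min δMx (min δRc d48)))`; «KE₉X» no longer displays `hM39`.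
# «ZK₃» (dag-n06-d g29) = «ZK₂» (✓p811827) + ONE ∀-parameter `a17 > 0` and ONE fact `q.a₁ ∕ c ≤ a17` — the A6 witness row of «KE₈X»'s new numeric
# `ha17 : q.a₁ ∕ c ≤ knitRow17a₁ N θ.toStage3Params M⋆` (read at `a17 := knitRow17a₁ …`, any positive real); witness `p.a₁ := min 1 (min (min aMx (c·aᴷ)) (min aRc (c·a17)))`;
# «KE₈X» no longer displays `hMR : 0 < MR` (ZK₂'s `∃ MR` kept, surplus). Everything else = ZK₂ VERBATIM (diff oracle: the tree file). ZK₂'s module text follows.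
#
# BalabanUVNodes ∕ N06 ([B9], `Dag.B9_main`) — WITNESS «ZK₂»: THE x-FREE NUMERIC DISPLAY OF THE KNIT HEAD «KE₆X», ALL 207 HYPOTHESES — «ZK» PLUS THE SEVEN ROWS
# `hqaK haIR haIK hδQs1 hδQs2 hδQs3 hCqK` AND THE FOUR ONE-STEP COUPLINGS `hpaK ha12K ha1J htJ` IN THE HEAD'S OWN SPELLING

Track A of `YM-PLAN.md` (cell `pub-ymgap`, HUMAN RULING D-0062), node **N06** = [Balaban1985BackgroundPropagators] Thms 3.1–3.15; acceleration seat `pub-ymgap-dag-n06-d` (gen 28).  A REFEREE AID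
(A6 on the numerics), not a certificate edition.  WHY.  Referee ref-A (g50 VERDICT-15) read the joint witness «ZK» (`N06NumericsWitnessZK.numerics_inhabited_KE6X`, ✓p809713) against the
207 x-free hypotheses of the knit head `N06AtOpsYSectEStKnitRecordKE6X.b9LeafXUR_opsYSectESt_knitRecord_KE6X` (✓p805384) and found 200 covered and SEVEN NOT: `hqaK : q.a₁∕c ≤ aᴷ` (no row
of «XK» relates the pin `q` to `p`, although X's proof takes both `:= pp`), `haIR : a_inv ≤ q.a₁∕c` and `haIK : a_inv ≤ aᴷ` (X's `a_inv := 1` is idle — its only row is `0 < a_inv` — and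
FALSE for them when `q.a₁∕c < 1`), `hδQs1–3` and `hCqK` (`δQs`, `CqK` are not ∃-quantities of «ZK»).  WHAT.  THIS FILE states «ZK»'s system VERBATIM (`MR := 1` ⊕ the knit-cluster window
`N06KnitClusterWindowKE6X.knitClusterWindow_inhabited_KE6X` ⊕ «XK»'s 207 rows read at `aMx := min aMx (c·aᴷ)`, `cJ := max (10·L⁷) (aᴷ)⁻¹`) with `(δQs CqK : ℝ)` appended to the inner
∃-prefix and FOURTEEN rows prepended, twelve of them binders of the head verbatim (`θ.d₆ θ.ℓ₆ ↦ d ℓ`): `hpaK : p.a₁ / c ≤ aK`, `hqaK : q.a₁ / c ≤ aK`, `haIK : aInv ≤ aK`, `ha12K : a12 ≤ aK`,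
`ha1J : 10 * L ^ 7 * a12 ≤ 1`, `htJ` (at `cJ = 10·L⁷`), `hδQs1 : δ12₀ + 1 ≤ δQs`, `hδQs2 : δ12₃ + σ12 ≤ δQs`, `hδQs3 : δ12₃ + 1 ≤ δQs`, `hCqK : 0 ≤ CqK`, `haIR : aInv ≤ q.a₁ / c`, and the
pin coincidence `q = p`.  PROOF.  The window lemma, then «XK»'s proof (✓p808926) re-run inside with three value changes — `pp.a₁ := min 1 (min (min aMx (c·aᴷ)) aRc)`, `cJ := max (10·L⁷) (aᴷ)⁻¹`
(its `0 ≤ cJ` proved, no longer a binder), `a_inv := pp.a₁ ∕ c` (so `0 < a_inv` is `div_pos`) — and the new entries `δQs := δ12₀ + 1 = 9s∕20 + 1`, `CqK := 0`, the couplings by one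
monotonicity step each (`div_le_iff₀`, `mul_inv_cancel_left₀`, `gcongr`), `q = p` by `rfl`; every other value and proof of «XK» unchanged (a 296-component destructuring of «XK»'s ∃ was tried
first and does not elaborate within 1 500 s on the farm, hence the re-run; `maxHeartbeats 2 400 000` as «XK», the one extra hypothesis being `0 < aᴷ`).  «XK»∕«ZK» stay as they are (append-only).

HONEST LABEL: a satisfiability witness for the numeric display only (referee aid A6); says nothing about the letter schemas or the displayed rows (`hΔAK`, `s349K`, the `𝔬12` pins, the
(3.42) tables …); count-neutral; N06 NOT discharged; nothing continuum ∕ OS ∕ mass gap ∕ Clay.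
[cite: Balaban1985BackgroundPropagators, Thm 3.3 (3.42)–(3.47) pp.397–399, Thm 3.7 (3.87)–(3.90) pp.408–410, Thm 3.11 p.416, p.409; Balaban1985Averaging, Prop. 2 p.26, Prop. 5 p.42, Prop. 7 p.43,
(139)–(147) pp.39–40; Balaban1984PropagatorsII, Lemma 2.1 (2.60)–(2.61) p.234, (2.147) p.248]
-/

noncomputable section

namespace Summit.QuantumFields.YangMills.BalabanUVNodes.N06NumericsWitnessZK7

open Literature.MathematicalPhysics.QuantumFieldTheory.Balaban1983to89
open Literature.MathematicalPhysics.QuantumFieldTheory.Balaban1983to89.B9RWSumsDefinitePins (PinPrims)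
open Literature.MathematicalPhysics.QuantumFieldTheory.Balaban1983to89.B9PinGeometryKLevelV1 (c35Y c35Y_pos)
open Literature.MathematicalPhysics.QuantumFieldTheory.Balaban1983to89.B9RWSumsDefinitePinsPair (PairPrims)
open Literature.MathematicalPhysics.QuantumFieldTheory.Balaban1983to89.B9RWSumsDefinitePinsPairM (MixedPrims)
open Literature.MathematicalPhysics.QuantumFieldTheory.Balaban1983to89.B9GeoNbrCountKLevelV1 (nbrM₀Y nbrCountY)
open Literature.MathematicalPhysics.QuantumFieldTheory.Balaban1983to89.B9GeoNbrCountBlocksY (nbrM₀BY nbrCountBY)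
open Literature.MathematicalPhysics.QuantumFieldTheory.Balaban1983to89.B7Prop2Explicit (C0 c2')
open Literature.MathematicalPhysics.QuantumFieldTheory.Balaban1983to89.B7Prop3Flat (c3)
open Literature.MathematicalPhysics.QuantumFieldTheory.Balaban1983to89.B7Prop5GeneralLevels (C3Gen thetaGen)
open Literature.MathematicalPhysics.QuantumFieldTheory.Balaban1983to89.B9PinMembersKLevelV1 (MemberY)
open scoped Matrix.Norms.L2Operator
open Literature.MathematicalPhysics.QuantumFieldTheory.Balaban1983to89.B9PinMembersKLevelV1 (geo9Y)
open Literature.MathematicalPhysics.QuantumFieldTheory.Balaban1983to89.B9CoReadingCoordsTranspose (trBasis)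
open Literature.MathematicalPhysics.QuantumFieldTheory.Balaban1983to89.B9Thm39ReadingCoords (cR39 coordBound39 basisBound39)
open Literature.MathematicalPhysics.QuantumFieldTheory.Balaban1983to89.B9Eq340TaxiContourLocalityY (rLB rLB_nonneg)
open Literature.MathematicalPhysics.QuantumFieldTheory.Balaban1983to89.B9Thm39ReadingAtLetters (basis39 κ39)
open Literature.MathematicalPhysics.QuantumFieldTheory.Balaban1983to89.B9MultiscaleSmoothPartitionYNear (rNear)
open Literature.MathematicalPhysics.QuantumFieldTheory.Balaban1983to89.B9MultiscaleSmoothPartitionYLip (CLip)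
open Literature.MathematicalPhysics.QuantumFieldTheory.Balaban1983to89.B9Thm313WholeDvHolderAtPinsGraded (thetaL CJG)
open Literature.MathematicalPhysics.QuantumFieldTheory.Balaban1983to89.B9RowSum261DefiniteFaces (rowConst261)
open Literature.MathematicalPhysics.QuantumFieldTheory.Balaban1983to89.B9WalkLettersCoordsS (nearBlkCntY)
open Literature.MathematicalPhysics.QuantumFieldTheory.Balaban1983to89.B9Ineq349SiteThresholdRateNamed (cg349)
open Literature.MathematicalPhysics.QuantumFieldTheory.Balaban1983to89.B9SmoothHolderClassPProducers (CTel)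

open B9C2FormBoxRegimeY (Kpl) open B6KLevelCensusIndexV1 (kGeo) open B7Prop5CplxLevels (epsCplx tauCplx) open B9Eq316AveragingTransposeZd (alphaQ) open B9Eq3115KnitLetterYOnto (kCol)
open B9Eq3132TentBumps (Cth) open N06KnitClusterWindowKE6X (knitClusterWindow_inhabited_KE6X)

set_option maxHeartbeats 3600000 in set_option synthInstance.maxSize 2048 in set_option maxRecDepth 8192 in
/-- ★★ **«ZK₇» — THE JOINT A6 WITNESS OF THE HEAD «KESC-AγI» ∕ «KE₁₅X-Aγ»** (gen 33, the h36b-consuming edition): «ZK₆» (`…N06NumericsWitnessZK6.numerics_inhabited_KESCAG`, ✓p824901)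
with two more ∀-parameters `B36 ≥ 0`, `d36 > 0` (read at dag-n06-d's named constants `gpd36B ∕ gpd36δ N θ.d₆ θ.ℓ₆ θ.hL'` of ✓`B9Cor36GpDirMemberBlocksAtRecordY`, whose signs are
✓`gpd36B_nonneg` ∕ ✓`gpd36δ_pos`) and the two new x-free numerics of the edition IN THE HEAD's SPELLING: `(B36 ≤ Bc)` (`hB36`) and `(p.δ₀ ≤ d36)` (`hδ36`).  Witness: «ZK₆»'s proof re-run with
`s := min 1 (min δ₄ (min δMx (min δRc (min d48 d36))))`, `Bc := B36`, `p.B₀ := max 1 (nbrCountBY·e²·c_R·B36)` (so that rows 18's key-transfer numeric `hB₀ge` still holds); every other value verbatim.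
The per-member thresholds `hM36 hN36 hT36` and the datum row `hDat36` are NOT x-free numerics and are not witnessed here.  «ZK₆»'s docstring follows verbatim.  ★★ **«ZK₄» — THE JOINT A6 WITNESS OF THE HEAD «KE₉X»**: «ZK₃» (`…N06NumericsWitnessZK3.numerics_inhabited_KE8X`, ✓p813173) with three more ∀-parameters `a48 B48 d48 > 0` and the
three facts `c35Y·a39 ≤ c·a48`, `B48 ≤ B39`, `δ39 ≤ d48` (KE₉X's rows `ha39K hB39K hδ39K`, in the head's spelling; instantiate at dag-n06-j's `knit348a₁ ∕ knit348B₀ ∕ knit348δ₀ N θ.toStage3Params M⋆`);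
«ZK₃» = «ZK₂» (✓p811827) + `∀ a17 > 0`, fact `q.a₁ ∕ c ≤ a17` (read at `a17 := knitRow17a₁ …`).  ZK₂'s docstring, verbatim: ★ **WITNESS «ZK₂» — ALL 207 x-FREE NUMERIC HYPOTHESES OF THE KNIT HEAD «KE₆X» ARE JOINTLY SATISFIABLE**: «ZK» (✓p809713: `MR := 1`; ONE knit-cluster tuple `α₀ᴷ aᴷ ϱ′ ϱ` for the
head's 24 knit-cluster displays, `N06KnitClusterWindowKE6X.knitClusterWindow_inhabited_KE6X`; «XK»'s whole system READ AT `aMx := min aMx (c·aᴷ)`, `cJ := max (10·L⁷) (aᴷ)⁻¹`) PLUS, in the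
head's own spelling, `hpaK hqaK haIK ha12K ha1J htJ hδQs1 hδQs2 hδQs3 hCqK haIR` and the pin coincidence `q = p` (ref-A g50 VERDICT-15's seven uncovered rows + the four one-step couplings).
Proof: the window lemma, then «XK»'s proof re-run at those values with `a_inv := p.a₁ ∕ c`, `δQs := δ12₀ + 1`, `CqK := 0`.  Needs `0 < b₀`, `0 ≤ b₁`.
[cite: Balaban1985BackgroundPropagators, Thm 3.3 (3.42)–(3.47) pp.397–399, Thm 3.11 p.416, p.409; Balaban1985Averaging, Prop. 2 p.26, Prop. 5 p.42; Balaban1984PropagatorsII, Lemma 2.1 (2.60) p.234] -/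
theorem numerics_inhabited_KESCGI (N d ℓ : ℕ) (hd : 1 ≤ d + 1) (hL : Odd (ℓ + 1) ∧ 1 < ℓ + 1) (b₀ b₁ : ℝ) (hb₀ : 0 < b₀) (hb₁ : 0 ≤ b₁) :
    ∃ MR : ℝ, 0 < MR ∧ ∃ α₀K aK ϱ' ϱ : ℝ, 0 < α₀K ∧ 0 < aK ∧ 0 < ϱ' ∧ 0 < ϱ ∧
      -- the knit cluster (2): `hαK3 hαK2 hαK4 hα8 hαQK hexpK hsmallK hKplK hαdK hα4N hαπN hsmall' hc₃' hϱ'1 hEc hdX hsmall hc₃ hT16` of the head, verbatim with `θ.d₆ θ.ℓ₆ θ.b₀ θ.b₁ ↦ d ℓ b₀ b₁`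
      C0 (d + 1) * α₀K ≤ 1 / 3 ∧ 2 * α₀K ≤ c2' (d + 1) (ℓ + 1) ∧ 4 * α₀K ≤ c2' (d + 1) (ℓ + 1) ∧ 8 * α₀K ≤ c2' (d + 1) (ℓ + 1) ∧
      α₀K ≤ alphaQ (d + 1) (ℓ + 1) ∧
      Real.exp (4 * (800 * (((d + 1 : ℕ) : ℝ) + 1) ^ 2 * (((d + 1 : ℕ) : ℝ) + 4)) * α₀K) < 2 ∧
      kCol (d + 1) (ℓ + 1) * α₀K < 1 ∧
      (∀ (i : B6KLevelCensusIndexV1.KIdx d ℓ hd hL b₀ b₁) (a : ℝ), 0 ≤ a → a ≤ aK → Kpl i a * (kGeo i).L ^ 4 < α₀K) ∧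
      ((d : ℝ) + 1) ^ 2 * α₀K ≤ 1 / 100 ∧
      32 * (((d + 1 : ℕ) : ℝ) + 1) * ((d + 1 : ℕ) + 4) * (((ℓ + 1 : ℕ) : ℝ)) ^ 2 * α₀K ≤ 1 / 4 ∧
      (N : ℝ) * (32 * (((d + 1 : ℕ) : ℝ) + 1) * ((d + 1 : ℕ) + 4) * (((ℓ + 1 : ℕ) : ℝ)) ^ 2 * α₀K) < Real.pi ∧
      Real.exp (4 * (800 * ((((d + 1 : ℕ) : ℝ)) + 1) ^ 2 * ((((d + 1 : ℕ) : ℝ)) + 4)) * α₀K) * (1 + 8 * (131072 * ((((d + 1 : ℕ) : ℝ)) + 1) ^ 2) * ϱ') ≤ 2 ∧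
      2 * ϱ' ≤ c3 (d + 1) (ℓ + 1) ∧
      409600 * ((((d + 1 : ℕ) : ℝ)) + 1) ^ 2 * ϱ' ≤ 1 ∧
      epsCplx (d + 1) (ℓ + 1) ϱ' 0 ≤ 1 / 16 ∧
      (((d + 1 : ℕ) : ℝ)) * (epsCplx (d + 1) (ℓ + 1) ϱ' 0 + tauCplx (d + 1) (ℓ + 1) α₀K 0 ϱ' 0) ≤ 1 / 16 ∧
      Real.exp (4480 * ((((d + 1 : ℕ) : ℝ)) + 1) ^ 2 * ((((d + 1 : ℕ) : ℝ)) + 4) * α₀K + 240000 * ((((d + 1 : ℕ) : ℝ)) + 1) ^ 3 * ϱ') *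
          (1 + 8 * (2097152 * ((((d + 1 : ℕ) : ℝ)) + 1) ^ 2) * ϱ) ≤ 2 ∧
      2 * ϱ ≤ c3 (d + 1) (ℓ + 1) / 4 ∧
      (α₀K * (2 * ((d : ℝ) + 1) * kCol (d + 1) (ℓ + 1) + 8 * ((d : ℝ) + 2) ^ 2)) ^ 2 * (2 * (N : ℝ) * b₁) * (2 * ((d : ℝ) + 1) * Cth d) ≤ b₀ / 256 ∧
    -- «XK»'s system (1)+(3) read at `aMx := min aMx (c·aK)` and `cJ := max (10·L⁷) aK⁻¹` (the `∀ cJ ≥ 0` binder of X is gone)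
    ∃ Mstar : ℕ, ∀ [∀ x : MemberY d ℓ hd hL b₀ b₁ Mstar, Fintype (geo9Y x).Site], ∀ δ₄ : ℝ, 0 < δ₄ → ∀ MMx aMx BMx δMx W : ℝ, 0 < MMx → 0 < aMx → 0 < BMx → 0 < δMx → 0 ≤ W →
      ∀ MRc aRc BRc δRc : ℝ, 0 < MRc → 0 < aRc → 0 < BRc → 0 < δRc → ∀ (Kc₀ : ℝ) (θW : ℝ → ℝ), 0 ≤ Kc₀ → (∀ C, 0 ≤ C → 0 ≤ θW C) → ∀ c : ℝ, 0 < c → ∀ a17 : ℝ, 0 < a17 → ∀ a48 B48 d48 : ℝ, 0 < a48 → 0 < B48 → 0 < d48 → ∀ M17 : ℝ, ∀ B36 d36 : ℝ, 0 ≤ B36 → 0 < d36 → ∃ (α' r39 δ39 B39 a39 M39 a311 M311 : ℝ) (p q : PinPrims) (p3 q3 : PairPrims) (pM qM : MixedPrims)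
      (δ12₀ δK12 σ12 ρ12 a12 M12 B12₃ δ12₃ ρ13 α12 ρf12 : ℝ) (Bq12 : ℝ → ℝ) (t12 δT12 ρS σS B13₄ : ℝ)
      (BhD13 Bx13 : ℝ → ℝ) (tJ δB rT δ₂ : ℝ) (Bx0 BdX : ℝ → ℝ) (a₀E δ₁E B₁E : ℝ) (w13 wX sch BZ : ℝ → ℝ) (ϑF δ45 : ℝ)
      (δ45Y : ℝ) (BiY : ℝ → ℝ) (αW σW δFW δ45W : ℝ) (B45W : ℝ → ℝ) (δhW : ℝ) (BhW : ℝ → ℝ) (CP s44 δ44 Bi44 : ℝ)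
      (B44G δ44G θK δKG B₀G δ₀G ρGs BHG : ℝ) (θHG : ℝ → ℝ) (B43 δ43 ρrg : ℝ) (τS δP Bx13₀ M₂ MInv aInv aW B₀D τR ρG κC δC2 Bc α₀' bb BcA : ℝ) (δQs CqK : ℝ),
      -- gen 28 «ZK₂» (ref-A g50 VERDICT-15): the head's couplings and free data IN THE HEAD'S OWN SPELLING — `hpaK hqaK haIK ha12K ha1J htJ hδQs1 hδQs2 hδQs3 hCqK`, then `q = p` and `haIR`
      (p.a₁ / c ≤ aK) ∧ (q.a₁ / c ≤ aK) ∧ (aInv ≤ aK) ∧ (a12 ≤ aK) ∧ (10 * ((ℓ + 1 : ℕ) : ℝ) ^ 7 * a12 ≤ 1) ∧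
      (2 * ((d : ℝ) + 1) * (((ℓ + 1 : ℕ) : ℝ)) ^ 3 * (N : ℝ) * (10 ^ 4 * ((d : ℝ) + 1) * (10 * ((ℓ + 1 : ℕ) : ℝ) ^ 7)) * Real.exp (3 * δB) ≤ tJ) ∧
      (δ12₀ + 1 ≤ δQs) ∧ (δ12₃ + σ12 ≤ δQs) ∧ (δ12₃ + 1 ≤ δQs) ∧ (0 ≤ CqK) ∧ (q = p) ∧ (aInv ≤ q.a₁ / c) ∧ (q.a₁ / c ≤ a17) ∧ (c35Y * a39 ≤ c * a48) ∧ (B48 ≤ B39) ∧ (δ39 ≤ d48) ∧ (M17 ≤ q.M₁) ∧ (B36 ≤ Bc) ∧ (p.δ₀ ≤ d36) ∧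
      -- «XK»'s 207 rows read at `aMx := min aMx (c·aK)` and `cJ := max (10·L⁷) aK⁻¹`, as in «ZK» verbatim
      (0 < α') ∧ (α' < 1) ∧ (0 < r39) ∧ (r39 ≤ δ39) ∧ (0 < B39) ∧ (0 < a39) ∧ (0 < M39) ∧ (0 < a311) ∧ (0 < M311) ∧
      p.OK ∧ q.OK ∧ p3.OK ∧ q3.OK ∧ pM.OK ∧ qM.OK ∧
      (nbrM₀Y d ℓ hd hL b₀ b₁ 2 ≤ Mstar) ∧ (nbrM₀Y d ℓ hd hL b₀ b₁ ((ℓ : ℝ) + 4) ≤ Mstar) ∧ (nbrM₀Y d ℓ hd hL b₀ b₁ 3 ≤ Mstar) ∧ (nbrM₀Y d ℓ hd hL b₀ b₁ (2 * ((d : ℝ) + 1)) ≤ Mstar) ∧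
      (0 < ρf12) ∧ (ρf12 + σ12 ≤ (1 - α12) * ρ12) ∧ (ρf12 + 2 * σ12 + α12 * ρ12 ≤ ρ12) ∧ (∀ β, 0 ≤ Bq12 β) ∧ (0 ≤ B12₃) ∧
      (0 < σ12) ∧ (0 < ρ12) ∧ (ρ12 ≤ δ12₀) ∧ (ρ12 + 2 * σ12 ≤ δK12) ∧ (ρ12 + σ12 ≤ δ12₃) ∧ (0 < a12) ∧ (0 < M12) ∧ (0 < α12) ∧ (α12 ≤ 1 / 2) ∧ (δ12₃ < δ12₀) ∧
      (δ12₀ ≤ (1 - 3 * q.αF) * ((1 - 2 * q.α) * q.δ₀)) ∧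
      (0 ≤ t12) ∧ (0 < σS) ∧ (ρS ≤ δT12) ∧ (ρS + σS ≤ δ12₀) ∧ (δK12 + q.αF * ((1 - 2 * q.α) * q.δ₀) ≤ ρS) ∧
      (M311 ≤ M12) ∧ ((2 : ℝ) * Real.log (((ℓ + 1 : ℕ) : ℝ)) ≤ δ12₃ * (2 * ((ℓ : ℝ) + 1) ^ 2 - 1) * M12) ∧ (a12 ≤ a311) ∧ (σS ≤ δK12) ∧ (0 < ρ13) ∧ (ρ13 + 5 * σ12 ≤ ρ12) ∧ (3 * σ12 < (1 - α12) * ρ13) ∧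
      (0 ≤ B13₄) ∧ (∀ β, 0 ≤ β → β < 1 → 0 ≤ BhD13 β) ∧
      (∀ β, 0 ≤ β → β < 1 → 0 ≤ Bx13 β) ∧ 
      (0 ≤ max (10 * (((ℓ + 1 : ℕ) : ℝ)) ^ 7) aK⁻¹) ∧ (max (10 * (((ℓ + 1 : ℕ) : ℝ)) ^ 7) aK⁻¹ * a12 ≤ 1) ∧ (2 * ((d : ℝ) + 1) * (((ℓ + 1 : ℕ) : ℝ)) ^ 3 * (N : ℝ) * (10 ^ 4 * ((d : ℝ) + 1) * max (10 * (((ℓ + 1 : ℕ) : ℝ)) ^ 7) aK⁻¹) * Real.exp (3 * δB) ≤ tJ) ∧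
      (rT ≤ min ((1 - 2 * p.α) * p.δ₀) δ39 / 8) ∧ (rT ≤ δB) ∧ (0 ≤ δT12) ∧ (δT12 + 3 * σS + 3 * (q.αF * ((1 - 2 * q.α) * q.δ₀)) ≤ rT) ∧
      (∀ β, 0 ≤ β → β < 1 → 0 ≤ Bx0 β) ∧ (∀ β, 0 ≤ β → β < 1 → 0 ≤ BdX β) ∧
      (0 < a₀E) ∧ (0 < δ₁E) ∧ (0 < B₁E) ∧ (rT ≤ δ₄) ∧ (rT ≤ δ₂) ∧ (δ12₃ ≤ (1 - 2 * q.αF) * rT - σS) ∧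
      (MMx ≤ p.M₁) ∧ (p.a₁ ≤ min aMx (c * aK)) ∧ (BMx ≤ pM.BM) ∧ (p.δ₀ ≤ δMx) ∧
      (MRc ≤ p.M₁) ∧ (p.a₁ ≤ aRc) ∧ (p.δ₀ ≤ δRc) ∧ (p.θ₀ * Real.exp ((3 / 4 + p.δ₀) * p.ρ) * (BRc * pM.BM) ≤ pM.θM) ∧ (W ≤ pM.NM) ∧
      (3 ≤ p.ρ) ∧ (W ≤ p.Nc) ∧ (W ≤ p.N') ∧ ((((ℓ + 1 : ℕ) : ℝ)) ^ 2 ≤ p.Cℓ) ∧ (Kc₀ ≤ p.Kc) ∧ (θW p.Cℓ ≤ p.θ₀) ∧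
      (∀ t, 0 ≤ w13 t) ∧ (∀ t, w13 t ≤ 1) ∧ (∀ t, 0 ≤ wX t) ∧ (∀ t, wX t ≤ 1) ∧ (∀ β', 0 ≤ β' → β' < 1 → 0 < sch β') ∧ (∀ β', 0 ≤ β' → β' < 1 → sch β' < 1) ∧
      (∀ β', 0 ≤ β' → β' < 1 → 0 < w13 (sch β')) ∧
      (2 * (10 * (((ℓ + 1 : ℕ) : ℝ)) * a12) * (1 + 10 * (((ℓ + 1 : ℕ) : ℝ)) * a12) * Real.exp (4 * (10 * (((ℓ + 1 : ℕ) : ℝ)) * a12)) * (((ℓ + 1 : ℕ) : ℝ)) ≤ ϑF) ∧ (δ12₃ < δ45) ∧ (∀ β', 0 ≤ β' → β' < 1 → 0 ≤ BZ β') ∧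
      -- editions 55, 57, 59, 53∕61 (in this order)
      (δ12₃ < δ45Y) ∧ (∀ β', 0 ≤ β' → β' < 1 → 0 ≤ BiY β') ∧
      (0 < αW) ∧ (αW < 1) ∧ (0 < σW) ∧ (0 < δFW) ∧ (δFW ≤ min ((1 - 2 * p.α) * p.δ₀) δ39 / 8) ∧ (0 ≤ δFW - αW * δFW - 2 * σW) ∧ (δ12₃ ≤ δFW - αW * δFW - 2 * σW) ∧
      (∀ β', 0 ≤ β' → β' < 1 → 0 < wX (sch β')) ∧ (δFW - αW * δFW - 2 * σW ≤ δ45W) ∧ (∀ β', 0 ≤ β' → β' < 1 → 0 ≤ B45W β') ∧ (δFW - αW * δFW - σW ≤ δhW) ∧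
      (∀ β', 0 ≤ β' → β' < 1 → 0 ≤ BhW β') ∧
      (((d + 1 : ℕ) : ℝ) * (coordBound39 (trBasis N) * basisBound39 (trBasis N) * nearBlkCntY d ℓ hd hL b₀ b₁ Mstar * ((max 1 (N : ℝ) * ((nbrCountY d ℓ hd hL b₀ b₁ 2 : ℝ) * p.C (B9RWSums347DefiniteFaces.exp261 (@geo9Y d ℓ hd hL b₀ b₁ Mstar) p.δ₀ p.α) * Real.exp (2 * ((1 - 2 * p.α) * p.δ₀)))) * (cR39 (basis39 (Matrix (Fin N) (Fin N) ℂ)) * Fintype.card (κ39 (Matrix (Fin N) (Fin N) ℂ)) * B39 * Real.exp (2 * δ39)) * (max 1 (N : ℝ) * ((nbrCountY d ℓ hd hL b₀ b₁ 2 : ℝ) * p.C (B9RWSums347DefiniteFaces.exp261 (@geo9Y d ℓ hd hL b₀ b₁ Mstar) p.δ₀ p.α) * Real.exp (2 * ((1 - 2 * p.α) * p.δ₀)))) * cg349 d ℓ hd hL b₀ b₁ ((1 - 2 * p.α) * p.δ₀) δ39) * Real.exp (2 * (min ((1 - 2 * p.α) * p.δ₀) δ39 / 8))) ≤ CP) 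∧
      (∀ β', 0 ≤ β' → β' < 1 → (cR39 (trBasis N))⁻¹ * ((wX (sch β'))⁻¹ * B45W β' + BhW β' * (CP * (((ℓ + 1 : ℕ) : ℝ))) * ((wX (sch β'))⁻¹ * ((((ℓ + 1 : ℕ) : ℝ)) * Real.exp ((δFW - αW * δFW - σW) * (rNear d ℓ + 1)))) * rowConst261 (@geo9Y d ℓ hd hL b₀ b₁ Mstar) σW * rowConst261 (@geo9Y d ℓ hd hL b₀ b₁ Mstar) σW) ≤ Bx13 β') ∧
      (0 < s44) ∧ (s44 < 1) ∧ (0 < w13 s44) ∧ (δ12₃ < δ44) ∧ (0 ≤ Bi44) ∧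
      (((d : ℝ) + 1) * ((1 + CLip d ℓ) * Bi44 * (CJG d ℓ (trBasis N) s44 (thetaL d ℓ ϑF) (w13 s44) (δ12₃ + 1 + 1 / 2 * (δ44 - δ12₃)) * (((ℓ + 1 : ℕ) : ℝ))) * rowConst261 (@geo9Y d ℓ hd hL b₀ b₁ Mstar) 1) ≤ B12₃) ∧
      (((d : ℝ) + 1) * (1 * (((d : ℝ) + 1) * ((1 + CLip d ℓ) * Bi44 * (CJG d ℓ (trBasis N) s44 (thetaL d ℓ ϑF) (w13 s44) (δ12₃ + 1 + 1 / 2 * (δ44 - δ12₃)) * (((ℓ + 1 : ℕ) : ℝ))) * rowConst261 (@geo9Y d ℓ hd hL b₀ b₁ Mstar) 1)) * rowConst261 (@geo9Y d ℓ hd hL b₀ b₁ Mstar) 1) ≤ B12₃) ∧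
      -- editions 65, 67′ (in this order)
      (0 < wX s44) ∧ (0 ≤ B44G) ∧ (δFW - αW * δFW - 2 * σW ≤ δ44G) ∧
      ((cR39 (trBasis N))⁻¹ * ((wX s44)⁻¹ * B44G + (((d + 1 : ℕ) : ℝ) * p.C (B9RWSums347DefiniteFaces.exp261 (@geo9Y d ℓ hd hL b₀ b₁ Mstar) p.δ₀ p.α)) * (CP * (((ℓ + 1 : ℕ) : ℝ))) * ((wX s44)⁻¹ * ((((ℓ + 1 : ℕ) : ℝ)) * Real.exp ((δFW - αW * δFW - σW) * (rNear d ℓ + 1)))) * rowConst261 (@geo9Y d ℓ hd hL b₀ b₁ Mstar) σW * rowConst261 (@geo9Y d ℓ hd hL b₀ b₁ Mstar) σW) ≤ B12₃) ∧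
      (0 ≤ θK) ∧ (∀ s, 0 < s → s < 1 → 0 ≤ θHG s) ∧ (0 ≤ B₀G) ∧ (0 ≤ BHG) ∧ (0 ≤ ρGs) ∧ (ρGs ≤ δ₀G) ∧ (ρGs + σW ≤ δKG) ∧
      (θK * rowConst261 (@geo9Y d ℓ hd hL b₀ b₁ Mstar) σW < 1) ∧ (∀ s, 0 < s → s < 1 → wX s * B9RWSums343Holder.holderConst (B9RWSums347DefiniteFaces.exp261 (@geo9Y d ℓ hd hL b₀ b₁ Mstar) q.δ₀ q.α) q.δ₀ q.α q.NH q.NF (B9Thm37Whole.const37 (B9RWSums347DefiniteFaces.exp261 (@geo9Y d ℓ hd hL b₀ b₁ Mstar) q.δ₀ q.α) q.δ₀ q.α q.ρ q.B₀ q.Nc q.N' q.Cℓ q.Kc) (q.Bl s) (q.Bt s) ≤ BHG) ∧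
      ((((ℓ + 1 : ℕ) : ℝ)) * Real.exp (ρGs * (rNear d ℓ + 1)) * (B₀G * (1 - θK * rowConst261 (@geo9Y d ℓ hd hL b₀ b₁ Mstar) σW)⁻¹ + BHG) ≤ B12₃) ∧ (δ12₃ ≤ ρGs) ∧
      (0 ≤ B43) ∧ (0 ≤ ρrg) ∧ (ρrg + σW + αW * δFW ≤ δFW) ∧ (ρrg + σW ≤ δ43) ∧ (δ12₃ ≤ ρrg) ∧
      (B43 * (cR39 (trBasis N))⁻¹ * rowConst261 (@geo9Y d ℓ hd hL b₀ b₁ Mstar) σW + CTel d ℓ (trBasis N) ρrg (CP * (((ℓ + 1 : ℕ) : ℝ)) * ((((d + 1 : ℕ) : ℝ) * p.C (B9RWSums347DefiniteFaces.exp261 (@geo9Y d ℓ hd hL b₀ b₁ Mstar) p.δ₀ p.α)) * (cR39 (trBasis N))⁻¹ * rowConst261 (@geo9Y d ℓ hd hL b₀ b₁ Mstar) σW) * rowConst261 (@geo9Y d ℓ hd hL b₀ b₁ Mstar) σW) (CP * (((ℓ + 1 : ℕ) : ℝ)) * ((((d + 1 : ℕ) : ℝ) * p.C (B9RWSums347DefiniteFaces.exp261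 (@geo9Y d ℓ hd hL b₀ b₁ Mstar) p.δ₀ p.α)) * (cR39 (trBasis N))⁻¹ * rowConst261 (@geo9Y d ℓ hd hL b₀ b₁ Mstar) σW) * rowConst261 (@geo9Y d ℓ hd hL b₀ b₁ Mstar) σW) ≤ B12₃) ∧
      -- editions 75∕76 (U8 state-layer budget + the (α3) thresholds; `hbud43T`, `hρS₃`, `hθV13` are gone with their binders)
      (0 < τS) ∧ (0 ≤ Bx13₀) ∧ (∀ s', 0 < s' → s' < 1 → wX s' * Bx13 s' ≤ Bx13₀) ∧ (ρ12 + 2 * σ12 ≤ δP) ∧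
      (δK12 + 3 * σS + 4 * τS ≤ (1 - 2 * p.α) * p.δ₀) ∧ (δK12 + 3 * σS + 4 * τS ≤ min ((1 - 2 * p.α) * p.δ₀) δ39 / 8) ∧ (δK12 + 3 * σS + 4 * τS ≤ δ₂) ∧
      (δK12 + 3 * σS + 5 * τS ≤ δ44G) ∧ (δK12 + 3 * σS + 4 * τS ≤ δB) ∧ (δK12 + 2 * σS + τS ≤ δ43) ∧ (δK12 + τS + σS ≤ δT12) ∧ (δK12 + τS + σS ≤ δ12₃) ∧
      (δK12 + τS + σS ≤ δP) ∧ (δP + 2 * τS ≤ δ12₀) ∧ (δP + σS + 2 * τS ≤ δ12₃) ∧ (δP + τS ≤ δ₀G) ∧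
      (0 ≤ M₂) ∧ (0 < MInv) ∧ (0 < aInv) ∧ (0 < aW) ∧ (2 * ((d : ℝ) + 1) < MInv) ∧ (rLB d ℓ + 1 < MInv) ∧
      -- edition 91 «UR»: the (3.43) input budget of dag-n06-c's `h43Gp_of_thm37PrintedSN` and the two transfer numerics (any class constant `c > 0`)
      (0 ≤ B₀D) ∧ (∀ s : ℝ, 0 < s → s < 1 → w13 s * ((((d + 1 : ℕ) : ℝ)) * (B9RWSums343Holder.holderConst (B9RWSums347DefiniteFaces.exp261 (@geo9Y d ℓ hd hL b₀ b₁ Mstar) p.δ₀ p.α) p.δ₀ p.α p.NH p.N' (p.C (B9RWSums347DefiniteFaces.exp261 (@geo9Y d ℓ hd hL b₀ b₁ Mstar) p.δ₀ p.α)) (p.Bl s) (p.Bt s) + 2 * B9Thm39ReadingCoords.coordBound39 (trBasis N) * B9Thm39ReadingCoords.basisBound39 (trBasis N) * ((ℓ : ℝ) + 1) * Real.exp (((1 - 2 * p.α) * p.δ₀) * (((d : ℝ) + 1) * (((ℓ : ℝ) + 1) + 1) + 2)) * ((((d + 1 : ℕ) : ℝ)) ^ 2 * (2 * (10 * ((ℓ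 + 1 : ℕ) : ℝ) * (p.a₁ / c)) * (1 + 10 * ((ℓ + 1 : ℕ) : ℝ) * (p.a₁ / c)) * Real.exp (4 * (10 * ((ℓ + 1 : ℕ) : ℝ) * (p.a₁ / c)))) * ((ℓ + 1 : ℕ) : ℝ) ^ 6) * (p.C (B9RWSums347DefiniteFaces.exp261 (@geo9Y d ℓ hd hL b₀ b₁ Mstar) p.δ₀ p.α)) + B9Thm39ReadingCoords.coordBound39 (trBasis N) * B9Thm39ReadingCoords.basisBound39 (trBasis N) * (p.C (B9RWSums347DefiniteFaces.exp261 (@geo9Y d ℓ hd hL b₀ b₁ Mstar) p.δ₀ p.α)) + (p.C (B9RWSums347DefiniteFaces.exp261 (@geo9Y d ℓ hd hL b₀ b₁ Mstar) p.δ₀ p.α)))) ≤ B₀D) ∧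
      ((((ℓ + 1 : ℕ) : ℝ)) * ((((d + 1 : ℕ) : ℝ)) * (p.C (B9RWSums347DefiniteFaces.exp261 (@geo9Y d ℓ hd hL b₀ b₁ Mstar) p.δ₀ p.α)) + B₀D) * Real.exp (((1 - 2 * p.α) * p.δ₀) * (rNear d ℓ + 1)) ≤ B43) ∧ (δ43 ≤ ((1 - 2 * p.α) * p.δ₀)) ∧
      -- edition 93 «UT»: the two transfer numerics of the `hpDGW` fold (dag-n06-c's a₀-uniform closed (3.44)-profile ≤ `BhW`, rate)
      (∀ β', 0 ≤ β' → β' < 1 → ((B9RWSums343Holder.holderConst (B9RWSums347DefiniteFaces.exp261 (@geo9Y d ℓ hd hL b₀ b₁ Mstar) p.δ₀ p.α) p.δ₀ p.α p.NH p.N' (p.C (B9RWSums347DefiniteFaces.exp261 (@geo9Y d ℓ hd hL b₀ b₁ Mstar) p.δ₀ p.α)) (p.Bl β') (p.Bt β') + 2 * B9Thm39ReadingCoords.coordBound39 (trBasis N) * B9Thm39ReadingCoords.basisBound39 (trBasis N) * ((ℓ : ℝ) + 1) * Real.exp (((1 - 2 * p.α) * p.δ₀) * (((d : ℝ) + 1)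 * (((ℓ : ℝ) + 1) + 1) + 2)) * ((((d + 1 : ℕ) : ℝ)) ^ 2 * (2 * (10 * ((ℓ + 1 : ℕ) : ℝ) * (p.a₁ / c)) * (1 + 10 * ((ℓ + 1 : ℕ) : ℝ) * (p.a₁ / c)) * Real.exp (4 * (10 * ((ℓ + 1 : ℕ) : ℝ) * (p.a₁ / c)))) * ((ℓ + 1 : ℕ) : ℝ) ^ 6) * (p.C (B9RWSums347DefiniteFaces.exp261 (@geo9Y d ℓ hd hL b₀ b₁ Mstar) p.δ₀ p.α)) + B9Thm39ReadingCoords.coordBound39 (trBasis N) * B9Thm39ReadingCoords.basisBound39 (trBasis N) * (p.C (B9RWSums347DefiniteFaces.exp261 (@geo9Y d ℓ hd hL b₀ b₁ Mstar) p.δ₀ p.α)) + (p.C (B9RWSums347DefiniteFaces.exp261 (@geo9Y d ℓ hd hL b₀ b₁ Mstar) p.δ₀ p.α))) + (p.C (B9RWSums347DefiniteFaces.exp261 (@geo9Y d ℓ hd hL b₀ b₁ Mstar) p.δ₀ p.α)) + B9Thm39ReadingCoords.coordBound39 (trBasis N) * B9Thm39ReadingCoords.basisBound39 (trBasis N) *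 (p.C (B9RWSums347DefiniteFaces.exp261 (@geo9Y d ℓ hd hL b₀ b₁ Mstar) p.δ₀ p.α))) ≤ BhW β') ∧ (δhW ≤ ((1 - 2 * p.α) * p.δ₀)) ∧
      -- edition 95 «UV» (in this order): `hα3`, `hschβ`, and the ten transfer numerics of the folds of `h44m h45X h45Y` (dag-n06-c `h44m_h45X_h45Y_of_local3107`, q-side) and `h44G hp45W` (`h44G_hp45W_of_thm37PrintedSN`, p-side)
      (3 * p.α ≤ (1 - p.αF) * (1 - 2 * p.α)) ∧ (∀ β', 0 ≤ β' → β' < 1 → β' < sch β') ∧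
      ((((ℓ + 1 : ℕ) : ℝ)) * B9RWSums344Input.inputConst44 (B9RWSums347DefiniteFaces.exp261 (@geo9Y d ℓ hd hL b₀ b₁ Mstar) q.δ₀ q.α) q.δ₀ q.α q.NI q.NF (B9Thm37Whole.const37 (B9RWSums347DefiniteFaces.exp261 (@geo9Y d ℓ hd hL b₀ b₁ Mstar) q.δ₀ q.α) q.δ₀ q.α q.ρ q.B₀ q.Nc q.N' q.Cℓ q.Kc) (((ℓ + 1 : ℕ) : ℝ)) (q.BI s44) (q.θI s44) ≤ Bi44) ∧ (δ44 ≤ ((1 - q.αF) * ((1 - 2 * q.α) * q.δ₀) - q.α * q.δ₀)) ∧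
      (∀ β', 0 ≤ β' → β' < 1 → (((ℓ + 1 : ℕ) : ℝ)) * B9RWSums344Input.inputConst45 (B9RWSums347DefiniteFaces.exp261 (@geo9Y d ℓ hd hL b₀ b₁ Mstar) q.δ₀ q.α) q.δ₀ q.α q.NI q.NF (((ℓ + 1 : ℕ) : ℝ)) (B9RWSums343Holder.holderConst (B9RWSums347DefiniteFaces.exp261 (@geo9Y d ℓ hd hL b₀ b₁ Mstar) q.δ₀ q.α) q.δ₀ q.α q.NH q.NF (B9Thm37Whole.const37 (B9RWSums347DefiniteFaces.exp261 (@geo9Y d ℓ hd hL b₀ b₁ Mstar) q.δ₀ q.α) q.δ₀ q.α q.ρ q.B₀ q.Nc q.N' q.Cℓ q.Kc) (q.Bl β') (q.Bt β')) (q.BI2 (sch β' - β') β') (q.θI (sch β')) ≤ BZ β') ∧ (δ45 ≤ ((1 - q.αF) * ((1 - 2 * q.α) * q.δ₀) - q.α * q.δ₀)) ∧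
      (∀ β', 0 ≤ β' → β' < 1 → (((ℓ + 1 : ℕ) : ℝ)) * B9RWSums344Input.inputConst45 (B9RWSums347DefiniteFaces.exp261 (@geo9Y d ℓ hd hL b₀ b₁ Mstar) q.δ₀ q.α) q.δ₀ q.α q.NI q.NF (((ℓ + 1 : ℕ) : ℝ)) (B9RWSums343Holder.holderConst (B9RWSums347DefiniteFaces.exp261 (@geo9Y d ℓ hd hL b₀ b₁ Mstar) q.δ₀ q.α) q.δ₀ q.α q.NH q.NF (B9Thm37Whole.const37 (B9RWSums347DefiniteFaces.exp261 (@geo9Y d ℓ hd hL b₀ b₁ Mstar) q.δ₀ q.α) q.δ₀ q.α q.ρ q.B₀ q.Nc q.N' q.Cℓ q.Kc) (q.Bl β') (q.Bt β')) (q.BI2 (sch β' - β') β') (q.θI (sch β')) ≤ BiY β') ∧ (δ45Y ≤ ((1 - q.αF) * ((1 - 2 * q.α) * q.δ₀) - q.α * q.δ₀)) ∧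
      ((((ℓ + 1 : ℕ) : ℝ)) * ((((d + 1 : ℕ) : ℝ)) * ((1 + CLip d ℓ) * B9RWSums344Input.inputConst44 (B9RWSums347DefiniteFaces.exp261 (@geo9Y d ℓ hd hL b₀ b₁ Mstar) p.δ₀ p.α) p.δ₀ p.α p.NI p.N' (p.C (B9RWSums347DefiniteFaces.exp261 (@geo9Y d ℓ hd hL b₀ b₁ Mstar) p.δ₀ p.α)) (((ℓ + 1 : ℕ) : ℝ)) (p.BI s44) (p.θI s44) * ((((ℓ + 1 : ℕ) : ℝ)) * ((((ℓ + 1 : ℕ) : ℝ)) ^ 3 * (2 + 2 * coordBound39 (trBasis N) * basisBound39 (trBasis N) * (((ℓ + 1 : ℕ) : ℝ)) ^ 2)) * Real.exp ((1 - p.αF) * ((1 - 2 * p.α) * p.δ₀) * (2 * (rNear d ℓ + 1) + (((d : ℝ) + 1) * (((ℓ : ℝ) + 1) + 1) + 2)))) * B6.c1 (B9RWSums347DefiniteFaces.exp261 (@geo9Y d ℓ hd hL b₀ b₁ Mstar) p.δ₀ p.α) p.δ₀ p.α)) ≤ B44G) ∧ (δ44G ≤ ((1 - p.αF) * ((1 -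 2 * p.α) * p.δ₀) - 3 * (p.α * p.δ₀))) ∧
      (∀ β', 0 ≤ β' → β' < 1 → (((d + 1 : ℕ) : ℝ)) * ((((((ℓ + 1 : ℕ) : ℝ)) * ((1 + CLip d ℓ) * B9RWSums344Input.inputConst45 (B9RWSums347DefiniteFaces.exp261 (@geo9Y d ℓ hd hL b₀ b₁ Mstar) p.δ₀ p.α) p.δ₀ p.α p.NI p.N' (((ℓ + 1 : ℕ) : ℝ)) (B9RWSums343Holder.holderConst (B9RWSums347DefiniteFaces.exp261 (@geo9Y d ℓ hd hL b₀ b₁ Mstar) p.δ₀ p.α) p.δ₀ p.α p.NH p.N' (p.C (B9RWSums347DefiniteFaces.exp261 (@geo9Y d ℓ hd hL b₀ b₁ Mstar) p.δ₀ p.α)) (p.Bl β') (p.Bt β')) (p.BI2 (sch β' - β') β') (p.θI (sch β')) * ((((ℓ + 1 : ℕ) : ℝ)) * ((((ℓ + 1 : ℕ) : ℝ)) ^ 3 * (2 + 2 * coordBound39 (trBasis N) * basisBound39 (trBasis N) * (((ℓ + 1 : ℕ) : ℝ)) ^ 2)) * Real.exp ((1 - p.αF) * ((1 - 2 * p.α)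 * p.δ₀) * (2 * (rNear d ℓ + 1) + (((d : ℝ) + 1) * (((ℓ : ℝ) + 1) + 1) + 2)))) * B6.c1 (B9RWSums347DefiniteFaces.exp261 (@geo9Y d ℓ hd hL b₀ b₁ Mstar) p.δ₀ p.α) p.δ₀ p.α)) + 2 * coordBound39 (trBasis N) * basisBound39 (trBasis N) * ((ℓ : ℝ) + 1) * Real.exp (((1 - p.αF) * ((1 - 2 * p.α) * p.δ₀) - 3 * (p.α * p.δ₀)) * (((d : ℝ) + 1) * (((ℓ : ℝ) + 1) + 1) + 2)) * ((((d + 1 : ℕ) : ℝ)) ^ 2 * (2 * (10 * (((ℓ + 1 : ℕ) : ℝ)) * (p.a₁ / c)) * (1 + 10 * (((ℓ + 1 : ℕ) : ℝ)) * (p.a₁ / c)) * Real.exp (4 * (10 * (((ℓ + 1 : ℕ) : ℝ)) * (p.a₁ / c)))) * (((ℓ + 1 : ℕ) : ℝ)) ^ 6) * ((((ℓ + 1 : ℕ) : ℝ)) * ((1 + CLip d ℓ) * B9RWSums344Input.inputConst44 (B9RWSums347DefiniteFaces.exp261 (@geo9Y d ℓ hd hL b₀ b₁ Mstar) p.δ₀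 p.α) p.δ₀ p.α p.NI p.N' (p.C (B9RWSums347DefiniteFaces.exp261 (@geo9Y d ℓ hd hL b₀ b₁ Mstar) p.δ₀ p.α)) (((ℓ + 1 : ℕ) : ℝ)) (p.BI (sch β')) (p.θI (sch β')) * ((((ℓ + 1 : ℕ) : ℝ)) * ((((ℓ + 1 : ℕ) : ℝ)) ^ 3 * (2 + 2 * coordBound39 (trBasis N) * basisBound39 (trBasis N) * (((ℓ + 1 : ℕ) : ℝ)) ^ 2)) * Real.exp ((1 - p.αF) * ((1 - 2 * p.α) * p.δ₀) * (2 * (rNear d ℓ + 1) + (((d : ℝ) + 1) * (((ℓ : ℝ) + 1) + 1) + 2)))) * B6.c1 (B9RWSums347DefiniteFaces.exp261 (@geo9Y d ℓ hd hL b₀ b₁ Mstar) p.δ₀ p.α) p.δ₀ p.α)) + coordBound39 (trBasis N) * basisBound39 (trBasis N) * ((((ℓ + 1 : ℕ) : ℝ)) * ((1 + CLip d ℓ) * B9RWSums344Input.inputConst44 (B9RWSums347DefiniteFaces.exp261 (@geo9Y d ℓ hd hL b₀ b₁ Mstar) p.δ₀ p.α) p.δ₀ p.α p.NI p.N' (p.C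 (B9RWSums347DefiniteFaces.exp261 (@geo9Y d ℓ hd hL b₀ b₁ Mstar) p.δ₀ p.α)) (((ℓ + 1 : ℕ) : ℝ)) (p.BI (sch β')) (p.θI (sch β')) * ((((ℓ + 1 : ℕ) : ℝ)) * ((((ℓ + 1 : ℕ) : ℝ)) ^ 3 * (2 + 2 * coordBound39 (trBasis N) * basisBound39 (trBasis N) * (((ℓ + 1 : ℕ) : ℝ)) ^ 2)) * Real.exp ((1 - p.αF) * ((1 - 2 * p.α) * p.δ₀) * (2 * (rNear d ℓ + 1) + (((d : ℝ) + 1) * (((ℓ : ℝ) + 1) + 1) + 2)))) * B6.c1 (B9RWSums347DefiniteFaces.exp261 (@geo9Y d ℓ hd hL b₀ b₁ Mstar) p.δ₀ p.α) p.δ₀ p.α)) + ((((ℓ + 1 : ℕ) : ℝ)) * ((1 + CLip d ℓ) * B9RWSums344Input.inputConst44 (B9RWSums347DefiniteFaces.exp261 (@geo9Y d ℓ hd hL b₀ b₁ Mstar) p.δ₀ p.α) p.δ₀ p.α p.NI p.N' (p.C (B9RWSums347DefiniteFaces.exp261 (@geo9Y d ℓ hd hL b₀ b₁ Mstar) p.δ₀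 p.α)) (((ℓ + 1 : ℕ) : ℝ)) (p.BI (sch β')) (p.θI (sch β')) * ((((ℓ + 1 : ℕ) : ℝ)) * ((((ℓ + 1 : ℕ) : ℝ)) ^ 3 * (2 + 2 * coordBound39 (trBasis N) * basisBound39 (trBasis N) * (((ℓ + 1 : ℕ) : ℝ)) ^ 2)) * Real.exp ((1 - p.αF) * ((1 - 2 * p.α) * p.δ₀) * (2 * (rNear d ℓ + 1) + (((d : ℝ) + 1) * (((ℓ : ℝ) + 1) + 1) + 2)))) * B6.c1 (B9RWSums347DefiniteFaces.exp261 (@geo9Y d ℓ hd hL b₀ b₁ Mstar) p.δ₀ p.α) p.δ₀ p.α))) + ((((ℓ + 1 : ℕ) : ℝ)) * ((1 + CLip d ℓ) * B9RWSums344Input.inputConst44 (B9RWSums347DefiniteFaces.exp261 (@geo9Y d ℓ hd hL b₀ b₁ Mstar) p.δ₀ p.α) p.δ₀ p.α p.NI p.N' (p.C (B9RWSums347DefiniteFaces.exp261 (@geo9Y d ℓ hd hL b₀ b₁ Mstar) p.δ₀ p.α)) (((ℓ + 1 : ℕ) : ℝ)) (p.BI (sch β')) (p.θI (sch β')) * ((((ℓ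 + 1 : ℕ) : ℝ)) * ((((ℓ + 1 : ℕ) : ℝ)) ^ 3 * (2 + 2 * coordBound39 (trBasis N) * basisBound39 (trBasis N) * (((ℓ + 1 : ℕ) : ℝ)) ^ 2)) * Real.exp ((1 - p.αF) * ((1 - 2 * p.α) * p.δ₀) * (2 * (rNear d ℓ + 1) + (((d : ℝ) + 1) * (((ℓ : ℝ) + 1) + 1) + 2)))) * B6.c1 (B9RWSums347DefiniteFaces.exp261 (@geo9Y d ℓ hd hL b₀ b₁ Mstar) p.δ₀ p.α) p.δ₀ p.α)) + coordBound39 (trBasis N) * basisBound39 (trBasis N) * ((((ℓ + 1 : ℕ) : ℝ)) * ((1 + CLip d ℓ) * B9RWSums344Input.inputConst44 (B9RWSums347DefiniteFaces.exp261 (@geo9Y d ℓ hd hL b₀ b₁ Mstar) p.δ₀ p.α) p.δ₀ p.α p.NI p.N' (p.C (B9RWSums347DefiniteFaces.exp261 (@geo9Y d ℓ hd hL b₀ b₁ Mstar) p.δ₀ p.α)) (((ℓ + 1 : ℕ) : ℝ)) (p.BI (sch β')) (p.θI (sch β')) * ((((ℓ + 1 : ℕ) : ℝ)) * ((((ℓ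 + 1 : ℕ) : ℝ)) ^ 3 * (2 + 2 * coordBound39 (trBasis N) * basisBound39 (trBasis N) * (((ℓ + 1 : ℕ) : ℝ)) ^ 2)) * Real.exp ((1 - p.αF) * ((1 - 2 * p.α) * p.δ₀) * (2 * (rNear d ℓ + 1) + (((d : ℝ) + 1) * (((ℓ : ℝ) + 1) + 1) + 2)))) * B6.c1 (B9RWSums347DefiniteFaces.exp261 (@geo9Y d ℓ hd hL b₀ b₁ Mstar) p.δ₀ p.α) p.δ₀ p.α))) ≤ B45W β') ∧ (δ45W ≤ ((1 - p.αF) * ((1 - 2 * p.α) * p.δ₀) - 3 * (p.α * p.δ₀))) ∧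
      -- edition 99 «UZ»: the (3.47) split window of dag-n06-c's `rgdDs_rgdDd_of_pinsR` (`hδ12₃F`)
      (δ12₃ ≤ (1 - 2 * p.αF) * ((1 - 2 * p.α) * p.δ₀)) ∧
      -- edition 109 «VJ»: the LEG margin `τR` of dag-n06-c's `rgdd_of_pinsT` and the U8 budget of the SECOND state layer (`…N06Rgdd13AtPinsPUW`): `hτR hR8a … hR8k`
      (0 < τR) ∧ (δ12₃ + 5 * τR + 3 * σS + 4 * τS ≤ (1 - 2 * p.α) * p.δ₀) ∧ (δ12₃ + 5 * τR + 3 * σS + 4 * τS ≤ min ((1 - 2 * p.α) * p.δ₀) δ39 / 8) ∧ (δ12₃ + 5 * τR + 3 * σS + 4 * τS ≤ δ₂) ∧ (δ12₃ + 5 * τR + 3 * σS + 5 * τS ≤ δ44G) ∧ (δ12₃ + 5 * τR + 3 * σS + 4 * τS ≤ δB) ∧ (δ12₃ + 5 * τR + 2 * σS + τS ≤ δ43) ∧ (δ12₃ + 5 * τR + τS + σS ≤ δT12) ∧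
      (δ12₃ + 5 * τR + 2 * σS + 3 * τS < δ12₀) ∧ (δ12₃ + 5 * τR + 2 * σS + 3 * τS < δ44) ∧ (δ12₃ + 5 * τR + 2 * σS + 3 * τS < δ45) ∧ (δ12₃ + 5 * τR + 2 * σS + 3 * τS < δ45Y) ∧
      -- edition 113 «VN»: the G_D road's rate `ρG` (`hρG hρGP hρGK`) and [5] (149)'s C⁽²⁾ form letter's constants (`hκC hgap`); the Δ⁽²⁾ letter's `θ₂` is DERIVED
      (0 < ρG) ∧ (ρG + σS ≤ δP) ∧ (ρG + 2 * σS ≤ δK12) ∧ (0 ≤ κC) ∧ (δ₂ < δC2) ∧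
      -- edition 115 «VQ»: rows 18's block tables' constant `Bc`, the all-blocks count threshold (`B9GeoNbrCountBlocksY`) and the key-transfer numeric of `B9BlockKeyTransferXSK`
      (0 ≤ Bc) ∧ (nbrM₀BY d ℓ hd hL b₀ b₁ 1 ≤ Mstar) ∧ ((nbrCountBY d ℓ hd hL b₀ b₁ 1 : ℝ) * Real.exp (2 * p.δ₀) * (cR39 (trBasis N) * Bc) ≤ p.B₀) ∧
      -- edition 117 «VS»: [5] (149)'s C⁽²⁾ form majorant DERIVED (dag-n06-l) ⇒ [B7]'s smallness window (Prop. 4 ∕ (145) ∕ (155)) in (d, L, a12, α₀′, bb), the budget `C₃·e^{2δC2(ℓ+4)} ≤ 2κC`, `0 ≤ δC2`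
      (2 * (10 * ((ℓ : ℝ) + 1) * a12) * (1 + 10 * ((ℓ : ℝ) + 1) * a12) * Real.exp (4 * (10 * ((ℓ : ℝ) + 1) * a12)) * ((ℓ : ℝ) + 1) ^ 4 < α₀') ∧ (C0 (d + 1) * α₀' ≤ 1 / 3) ∧ (4 * α₀' ≤ c2' (d + 1) (ℓ + 1)) ∧ (0 < bb) ∧ (Real.exp (4 * (800 * (((d + 1 : ℕ) : ℝ) + 1) ^ 2 * (((d + 1 : ℕ) : ℝ) + 4)) * α₀') * (1 + 8 * (131072 * (((d + 1 : ℕ) : ℝ) + 1) ^ 2) * bb) ≤ 2) ∧ (4 * bb < c3 (d + 1) (ℓ + 1)) ∧ (8 * ((d + 1 : ℕ) : ℝ) * thetaGen (d + 1) (ℓ + 1) α₀' * ((ℓ : ℝ) + 1)⁻¹ ^ 4 ≤ 1) ∧ ((2 * ((ℓ : ℝ) + 1) - 1) * ((ℓ : ℝ) + 1)⁻¹ ^ 2 + 2 * ((d + 1 : ℕ) : ℝ) * thetaGen (d + 1) (ℓ + 1) α₀' * ((ℓ : ℝ) + 1)⁻¹ ^ 3 + 1 / 8 * (1 + 2 *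 ((d + 1 : ℕ) : ℝ) * thetaGen (d + 1) (ℓ + 1) α₀' * ((ℓ : ℝ) + 1)⁻¹ ^ 2 + 2 * ((d + 1 : ℕ) : ℝ) * C3Gen (d + 1) (ℓ + 1) * bb) * ((ℓ : ℝ) + 1)⁻¹ ^ 2 ≤ 1) ∧ (C3Gen (d + 1) (ℓ + 1) * Real.exp (2 * δC2 * ((ℓ : ℝ) + 4)) ≤ 2 * κC) ∧ (0 ≤ δC2) ∧
      -- edition 119 «VU»: rows 19's bond block tables' constant `BcA` and the bond key-transfer numeric of `B9BlockKeyTransferXBK`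
      (0 ≤ BcA) ∧ ((nbrCountBY d ℓ hd hL b₀ b₁ 1 : ℝ) * Real.exp (2 * q.δ₀) * (cR39 (trBasis N) * BcA) ≤ q.B₀) ∧
      -- edition W-b «KESC-A» (dag-n06-d g31): the static thresholds of the rows-19 bond-sector walk-letter record `ops310WalkYO` — `hρ3A hNcA hN'A hCℓA hKcA` (twins of the site `hρ3 hNc hN' hCℓ hKc`, same `W`, `Kc₀`)
      (3 ≤ q.ρ) ∧ (W ≤ q.Nc) ∧ (W ≤ q.N') ∧ ((((ℓ + 1 : ℕ) : ℝ)) ^ 2 ≤ q.Cℓ) ∧ (Kc₀ ≤ q.Kc) := by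
  obtain ⟨α₀Kv, aKv, ϱ'v, ϱv, hα0, -, haK, hϱ', hϱ, h3, h2, h4, h8, hQ, hexp, hkc, hKpl, hd100, h4N, hπN, hs', hc3', hϱ1, hEc, hdX, hs, hc3, hT16⟩ :=
    knitClusterWindow_inhabited_KE6X d ℓ N hb₀ hb₁ one_pos
  refine ⟨1, one_pos, α₀Kv, aKv, ϱ'v, ϱv, hα0, haK, hϱ', hϱ, h3, h2, h4, h8, hQ, hexp, hkc, fun i a h0 h1 => hKpl i a h0 h1, hd100, h4N, hπN, hs', hc3', hϱ1, hEc, hdX, hs,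
    hc3, hT16, ?_⟩
  -- keep ONLY `haK : 0 < aᴷ` of the cluster in the context of «XK»'s re-run (every extra comparison hypothesis costs its ~60 `linarith` calls)
  clear hα0 hϱ' hϱ h3 h2 h4 h8 hQ hexp hkc hKpl hd100 h4N hπN hs' hc3' hϱ1 hEc hdX hs hc3 hT16 hb₀ hb₁
  -- «XK»'s proof (✓p808926) verbatim, read at `aMx := min aMx (c·aᴷ)` (in `pp.a₁`), `cJ := max (10·L⁷) (aᴷ)⁻¹` (`hcJ` proved, no longer a binder), `a_inv := pp.a₁ ∕ c`
  -- as `numerics_inhabited_ed47` (+ `w13 wX sch := 1/2`, `BZ := 0`, `ϑF :=` budget, `δ45 := δ12₃ + 1`), i.e. `numerics_inhabited_ed43` with `p.ρ := 3`, `p.Nc := p.N' := W`, `p.Cℓ := L²`, `p.Kc := Kc₀`, `p.θ₀ := θW (L²)`, `pM.θM := θW(L²)·e^{(3/4+s)·3}·BRc`, `M⋆ ≥ nbrM₀Y 3`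
  -- [«XK» (i)] `M⋆ := max (X's M⋆) (nbrM₀Y … (2(d+1)))`, opaque, its five floors packed in ONE ∧-hypothesis (invisible to `linarith`'s preprocessing)
  obtain ⟨Mst, hMfl⟩ : ∃ M : ℕ, (((nbrM₀Y d ℓ hd hL b₀ b₁ 2 ≤ M ∧ nbrM₀Y d ℓ hd hL b₀ b₁ ((ℓ : ℝ) + 4) ≤ M) ∧ nbrM₀Y d ℓ hd hL b₀ b₁ 3 ≤ M) ∧ nbrM₀BY d ℓ hd hL b₀ b₁ 1 ≤ M) ∧
      nbrM₀Y d ℓ hd hL b₀ b₁ (2 * ((d : ℝ) + 1)) ≤ M :=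
    ⟨max (max (max (max (nbrM₀Y d ℓ hd hL b₀ b₁ 2) (nbrM₀Y d ℓ hd hL b₀ b₁ ((ℓ : ℝ) + 4))) (nbrM₀Y d ℓ hd hL b₀ b₁ 3)) (nbrM₀BY d ℓ hd hL b₀ b₁ 1)) (nbrM₀Y d ℓ hd hL b₀ b₁ (2 * ((d : ℝ) + 1))),
      ⟨⟨⟨(((le_max_left _ _).trans (le_max_left _ _)).trans (le_max_left _ _)).trans (le_max_left _ _),
        (((le_max_right _ _).trans (le_max_left _ _)).trans (le_max_left _ _)).trans (le_max_left _ _)⟩,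
        ((le_max_right _ _).trans (le_max_left _ _)).trans (le_max_left _ _)⟩, (le_max_right _ _).trans (le_max_left _ _)⟩, le_max_right _ _⟩
  refine ⟨Mst,
    fun δ₄ hδ₄ MMx aMx BMx δMx W hMMx haMx hBMx hδMx hW MRc aRc BRc δRc hMRc haRc hBRc hδRc Kc₀ θW hKc₀ hθW c hc a17 ha17 a48 B48 d48 ha48 hB48 hd48 M17 B36 d36 hB36 hd36 => ?_⟩
  have hcJ : (0 : ℝ) ≤ max (10 * (((ℓ + 1 : ℕ) : ℝ)) ^ 7) aKv⁻¹ := le_trans (by positivity) (le_max_left _ _)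
  set s : ℝ := min 1 (min δ₄ (min δMx (min δRc (min d48 d36)))) with hsdef
  have hs : 0 < s := lt_min one_pos (lt_min hδ₄ (lt_min hδMx (lt_min hδRc (lt_min hd48 hd36))))
  have hs4 : s ≤ δ₄ := (min_le_right _ _).trans (min_le_left _ _)
  have hsM : s ≤ δMx := (min_le_right _ _).trans ((min_le_right _ _).trans (min_le_left _ _))
  have hsR : s ≤ δRc := (min_le_right _ _).trans ((min_le_right _ _).trans ((min_le_right _ _).trans (min_le_left _ _)))
  have hs48 : s ≤ d48 := (min_le_right _ _).trans ((min_le_right _ _).trans ((min_le_right _ _).trans ((min_le_right _ _).trans (min_le_left _ _))))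
  have hs36 : s ≤ d36 := (min_le_right _ _).trans ((min_le_right _ _).trans ((min_le_right _ _).trans ((min_le_right _ _).trans (min_le_right _ _))))
  have hs1 : s ≤ 1 := min_le_left _ _
  have hL2 : (1 : ℝ) ≤ (((ℓ + 1 : ℕ) : ℝ)) ^ 2 := one_le_pow₀ (by exact_mod_cast Nat.succ_le_succ (Nat.zero_le ℓ))
  obtain ⟨αv, bv, a12v, _hαv0, hbb, ha12v0, ha12v1, hα3, hα4, hsmall, hc₃, h145, h155, hKa⟩ := B7Prop5WindowNumerics.b7Window_inhabited_le d ℓ hL.2 (amax := 1 / ((max (10 * (((ℓ + 1 : ℕ) : ℝ)) ^ 7) aKv⁻¹) + 1)) (by positivity)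
  obtain ⟨κCv, hκC0, hκ2⟩ := B7Prop5WindowNumerics.kappaC_inhabited d ℓ (s / 16 + 1)
  let pp : PinPrims :=
    { α := 1 / 8, ρ := 3, Nc := W, N' := W, NF := 0, Cℓ := (((ℓ + 1 : ℕ) : ℝ)) ^ 2, Kc := Kc₀, θ₀ := θW ((((ℓ + 1 : ℕ) : ℝ)) ^ 2), B₀ := max 1 ((nbrCountBY d ℓ hd hL b₀ b₁ 1 : ℝ) * Real.exp 2 * (cR39 (trBasis N) * B36)), δ₀ := s, a₁ := min 1 (min (min aMx (c * aKv)) (min aRc (c * a17))), M₁ := max 1 (max MMx (max MRc M17)), αF := 1 / 1000,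
      NH := 0, NL := 0, BL := 0, NI := 0, N2 := 0, B2 := 0, θ2 := 0, Bl := fun _ => 0, Bt := fun _ => 0, BI := fun _ => 0, θI := fun _ => 0,
      BI2 := fun _ _ => 0 }
  have hpp : pp.OK :=
    { α_pos := by norm_num [pp], α_lt := by norm_num [pp], Nc_nn := hW, N'_nn := hW, NF_nn := le_rfl, one_le_Cℓ := hL2, Kc_nn := hKc₀,
      θ₀_nn := hθW _ (by positivity), B₀_pos := lt_of_lt_of_le one_pos (le_max_left _ _), δ₀_pos := hs, a₁_pos := lt_min one_pos (lt_min (lt_min haMx (mul_pos hc haK)) (lt_min haRc (mul_pos hc ha17))), M₁_pos := lt_of_lt_of_le one_pos (le_max_left _ _),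
      αF_pos := by norm_num [pp], αF_lt := by norm_num [pp], NH_nn := le_rfl, NL_nn := le_rfl, BL_nn := le_rfl, NI_nn := le_rfl, N2_nn := le_rfl,
      B2_nn := le_rfl, θ2_nn := le_rfl, Bl_nn := fun _ _ _ => le_rfl, Bt_nn := fun _ _ _ => le_rfl, BI_nn := fun _ _ _ => le_rfl,
      BI2_nn := fun _ _ _ _ _ _ => le_rfl, θI_nn := fun _ _ => le_rfl }
  have hα : pp.α = 1 / 8 := rfl
  have hδ : pp.δ₀ = s := rfl
  have hB0ge36 : (nbrCountBY d ℓ hd hL b₀ b₁ 1 : ℝ) * Real.exp (2 * pp.δ₀) * (cR39 (trBasis N) * B36) ≤ pp.B₀ := by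
    have h1 : Real.exp (2 * pp.δ₀) ≤ Real.exp 2 := Real.exp_le_exp.2 (by rw [hδ]; linarith)
    have hc : 0 ≤ cR39 (trBasis N) * B36 := mul_nonneg (B9Thm39ReadingCoords.cR39_nonneg (trBasis N)) hB36
    exact le_trans (mul_le_mul_of_nonneg_right (mul_le_mul_of_nonneg_left h1 (Nat.cast_nonneg _)) hc) (le_max_right _ _)
  have hF : pp.αF = 1 / 1000 := rfl
  set CPw : ℝ := ((d + 1 : ℕ) : ℝ) * (coordBound39 (trBasis N) * basisBound39 (trBasis N) * nearBlkCntY d ℓ hd hL b₀ b₁ (Mst) * ((max 1 (N : ℝ) * ((nbrCountY d ℓ hd hL b₀ b₁ 2 : ℝ) * pp.C (B9RWSums347DefiniteFaces.exp261 (@geo9Y d ℓ hd hL b₀ b₁ (Mst)) pp.δ₀ pp.α) * Real.exp (2 * ((1 - 2 * pp.α) * pp.δ₀)))) * (cR39 (basis39 (Matrix (Fin N) (Fin N) ℂ)) * Fintype.card (κ39 (Matrix (Fin N) (Fin N) ℂ)) * max 1 B48 * Real.exp (2 * s)) * (max 1 (N : ℝ) * ((nbrCountY d ℓ hd hL b₀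 b₁ 2 : ℝ) * pp.C (B9RWSums347DefiniteFaces.exp261 (@geo9Y d ℓ hd hL b₀ b₁ (Mst)) pp.δ₀ pp.α) * Real.exp (2 * ((1 - 2 * pp.α) * pp.δ₀)))) * cg349 d ℓ hd hL b₀ b₁ ((1 - 2 * pp.α) * pp.δ₀) s) * Real.exp (2 * (min ((1 - 2 * pp.α) * pp.δ₀) s / 8))) with hCPw
  let BIG0 : ℝ := ((((d + 1 : ℕ) : ℝ)) * (B9RWSums343Holder.holderConst (B9RWSums347DefiniteFaces.exp261 (@geo9Y d ℓ hd hL b₀ b₁ (Mst)) pp.δ₀ pp.α) pp.δ₀ pp.α pp.NH pp.N' (pp.C (B9RWSums347DefiniteFaces.exp261 (@geo9Y d ℓ hd hL b₀ b₁ (Mst)) pp.δ₀ pp.α)) (pp.Bl 0) (pp.Bt 0) + 2 * B9Thm39ReadingCoords.coordBound39 (trBasis N) * B9Thm39ReadingCoords.basisBound39 (trBasis N) * ((ℓ : ℝ) + 1) * Real.exp (((1 - 2 * pp.α) * pp.δ₀) * (((d : ℝ) + 1) * (((ℓ : ℝ) + 1) + 1) + 2)) * ((((d + 1 : ℕ)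 : ℝ)) ^ 2 * (2 * (10 * ((ℓ + 1 : ℕ) : ℝ) * (pp.a₁ / c)) * (1 + 10 * ((ℓ + 1 : ℕ) : ℝ) * (pp.a₁ / c)) * Real.exp (4 * (10 * ((ℓ + 1 : ℕ) : ℝ) * (pp.a₁ / c)))) * ((ℓ + 1 : ℕ) : ℝ) ^ 6) * (pp.C (B9RWSums347DefiniteFaces.exp261 (@geo9Y d ℓ hd hL b₀ b₁ (Mst)) pp.δ₀ pp.α)) + B9Thm39ReadingCoords.coordBound39 (trBasis N) * B9Thm39ReadingCoords.basisBound39 (trBasis N) * (pp.C (B9RWSums347DefiniteFaces.exp261 (@geo9Y d ℓ hd hL b₀ b₁ (Mst)) pp.δ₀ pp.α)) + (pp.C (B9RWSums347DefiniteFaces.exp261 (@geo9Y d ℓ hd hL b₀ b₁ (Mst)) pp.δ₀ pp.α))))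
  let B0D : ℝ := max 0 ((1 / 2 : ℝ) * BIG0)
  let K43 : ℝ := (((ℓ + 1 : ℕ) : ℝ)) * ((((d + 1 : ℕ) : ℝ)) * (pp.C (B9RWSums347DefiniteFaces.exp261 (@geo9Y d ℓ hd hL b₀ b₁ (Mst)) pp.δ₀ pp.α)) + B0D) * Real.exp (((1 - 2 * pp.α) * pp.δ₀) * (rNear d ℓ + 1))
  let KW : ℝ := ((B9RWSums343Holder.holderConst (B9RWSums347DefiniteFaces.exp261 (@geo9Y d ℓ hd hL b₀ b₁ (Mst)) pp.δ₀ pp.α) pp.δ₀ pp.α pp.NH pp.N' (pp.C (B9RWSums347DefiniteFaces.exp261 (@geo9Y d ℓ hd hL b₀ b₁ (Mst)) pp.δ₀ pp.α)) (pp.Bl 0) (pp.Bt 0) + 2 * B9Thm39ReadingCoords.coordBound39 (trBasis N) * B9Thm39ReadingCoords.basisBound39 (trBasis N) * ((ℓ : ℝ) + 1) * Real.exp (((1 - 2 * pp.α) * pp.δ₀) * (((d : ℝ) + 1) * (((ℓ : ℝ) + 1) + 1) + 2)) * ((((d + 1 : ℕ) : ℝ)) ^ 2 * (2 * (10 * ((ℓ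 + 1 : ℕ) : ℝ) * (pp.a₁ / c)) * (1 + 10 * ((ℓ + 1 : ℕ) : ℝ) * (pp.a₁ / c)) * Real.exp (4 * (10 * ((ℓ + 1 : ℕ) : ℝ) * (pp.a₁ / c)))) * ((ℓ + 1 : ℕ) : ℝ) ^ 6) * (pp.C (B9RWSums347DefiniteFaces.exp261 (@geo9Y d ℓ hd hL b₀ b₁ (Mst)) pp.δ₀ pp.α)) + B9Thm39ReadingCoords.coordBound39 (trBasis N) * B9Thm39ReadingCoords.basisBound39 (trBasis N) * (pp.C (B9RWSums347DefiniteFaces.exp261 (@geo9Y d ℓ hd hL b₀ b₁ (Mst)) pp.δ₀ pp.α)) + (pp.C (B9RWSums347DefiniteFaces.exp261 (@geo9Y d ℓ hd hL b₀ b₁ (Mst)) pp.δ₀ pp.α))) + (pp.C (B9RWSums347DefiniteFaces.exp261 (@geo9Y d ℓ hd hL b₀ b₁ (Mst)) pp.δ₀ pp.α)) + B9Thm39ReadingCoords.coordBound39 (trBasis N) * B9Thm39ReadingCoords.basisBound39 (trBasis N) * (pp.C (B9RWSums347DefiniteFaces.exp261 (@geo9Y d ℓ hd hL b₀ b₁ (Mst))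 pp.δ₀ pp.α)))
  let ϑFv : ℝ := 2 * (10 * (((ℓ + 1 : ℕ) : ℝ)) * a12v) * (1 + 10 * (((ℓ + 1 : ℕ) : ℝ)) * a12v) * Real.exp (4 * (10 * (((ℓ + 1 : ℕ) : ℝ)) * a12v)) * (((ℓ + 1 : ℕ) : ℝ))
  let K44m : ℝ := (((ℓ + 1 : ℕ) : ℝ)) * B9RWSums344Input.inputConst44 (B9RWSums347DefiniteFaces.exp261 (@geo9Y d ℓ hd hL b₀ b₁ (Mst)) pp.δ₀ pp.α) pp.δ₀ pp.α pp.NI pp.NF (B9Thm37Whole.const37 (B9RWSums347DefiniteFaces.exp261 (@geo9Y d ℓ hd hL b₀ b₁ (Mst)) pp.δ₀ pp.α) pp.δ₀ pp.α pp.ρ pp.B₀ pp.Nc pp.N' pp.Cℓ pp.Kc) (((ℓ + 1 : ℕ) : ℝ)) (pp.BI (1 / 2)) (pp.θI (1 / 2))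
  let K45 : ℝ := (((ℓ + 1 : ℕ) : ℝ)) * B9RWSums344Input.inputConst45 (B9RWSums347DefiniteFaces.exp261 (@geo9Y d ℓ hd hL b₀ b₁ (Mst)) pp.δ₀ pp.α) pp.δ₀ pp.α pp.NI pp.NF (((ℓ + 1 : ℕ) : ℝ)) (B9RWSums343Holder.holderConst (B9RWSums347DefiniteFaces.exp261 (@geo9Y d ℓ hd hL b₀ b₁ (Mst)) pp.δ₀ pp.α) pp.δ₀ pp.α pp.NH pp.NF (B9Thm37Whole.const37 (B9RWSums347DefiniteFaces.exp261 (@geo9Y d ℓ hd hL b₀ b₁ (Mst)) pp.δ₀ pp.α) pp.δ₀ pp.α pp.ρ pp.B₀ pp.Nc pp.N' pp.Cℓ pp.Kc) (pp.Bl 0) (pp.Bt 0)) (pp.BI2 0 0) (pp.θI 0)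
  let K44G : ℝ := (((ℓ + 1 : ℕ) : ℝ)) * ((((d + 1 : ℕ) : ℝ)) * ((1 + CLip d ℓ) * B9RWSums344Input.inputConst44 (B9RWSums347DefiniteFaces.exp261 (@geo9Y d ℓ hd hL b₀ b₁ (Mst)) pp.δ₀ pp.α) pp.δ₀ pp.α pp.NI pp.N' (pp.C (B9RWSums347DefiniteFaces.exp261 (@geo9Y d ℓ hd hL b₀ b₁ (Mst)) pp.δ₀ pp.α)) (((ℓ + 1 : ℕ) : ℝ)) (pp.BI (1 / 2)) (pp.θI (1 / 2)) * ((((ℓ + 1 : ℕ) : ℝ)) * ((((ℓ + 1 : ℕ) : ℝ)) ^ 3 * (2 + 2 * coordBound39 (trBasis N) * basisBound39 (trBasis N) * (((ℓ + 1 : ℕ) : ℝ)) ^ 2)) * Real.exp ((1 - pp.αF) * ((1 - 2 * pp.α) * pp.δ₀) * (2 * (rNear d ℓ + 1) + (((d : ℝ) + 1) * (((ℓ : ℝ) + 1) + 1) + 2)))) * B6.c1 (B9RWSums347DefiniteFaces.exp261 (@geo9Y d ℓ hd hL b₀ b₁ (Mst)) pp.δ₀ pp.α) pp.δ₀ pp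.α))
  let K45W : ℝ := (((d + 1 : ℕ) : ℝ)) * ((((((ℓ + 1 : ℕ) : ℝ)) * ((1 + CLip d ℓ) * B9RWSums344Input.inputConst45 (B9RWSums347DefiniteFaces.exp261 (@geo9Y d ℓ hd hL b₀ b₁ (Mst)) pp.δ₀ pp.α) pp.δ₀ pp.α pp.NI pp.N' (((ℓ + 1 : ℕ) : ℝ)) (B9RWSums343Holder.holderConst (B9RWSums347DefiniteFaces.exp261 (@geo9Y d ℓ hd hL b₀ b₁ (Mst)) pp.δ₀ pp.α) pp.δ₀ pp.α pp.NH pp.N' (pp.C (B9RWSums347DefiniteFaces.exp261 (@geo9Y d ℓ hd hL b₀ b₁ (Mst)) pp.δ₀ pp.α)) (pp.Bl 0) (pp.Bt 0)) (pp.BI2 0 0) (pp.θI 0) * ((((ℓ + 1 : ℕ) : ℝ)) * ((((ℓ + 1 : ℕ) : ℝ)) ^ 3 * (2 + 2 * coordBound39 (trBasis N) * basisBound39 (trBasis N) * (((ℓ + 1 : ℕ) : ℝ)) ^ 2)) * Real.exp ((1 - pp.αF) * ((1 - 2 * pp.α) * pp.δ₀) * (2 * (rNear d ℓ + 1) + (((d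 : ℝ) + 1) * (((ℓ : ℝ) + 1) + 1) + 2)))) * B6.c1 (B9RWSums347DefiniteFaces.exp261 (@geo9Y d ℓ hd hL b₀ b₁ (Mst)) pp.δ₀ pp.α) pp.δ₀ pp.α)) + 2 * coordBound39 (trBasis N) * basisBound39 (trBasis N) * ((ℓ : ℝ) + 1) * Real.exp (((1 - pp.αF) * ((1 - 2 * pp.α) * pp.δ₀) - 3 * (pp.α * pp.δ₀)) * (((d : ℝ) + 1) * (((ℓ : ℝ) + 1) + 1) + 2)) * ((((d + 1 : ℕ) : ℝ)) ^ 2 * (2 * (10 * (((ℓ + 1 : ℕ) : ℝ)) * (pp.a₁ / c)) * (1 + 10 * (((ℓ + 1 : ℕ) : ℝ)) * (pp.a₁ / c)) * Real.exp (4 * (10 * (((ℓ + 1 : ℕ) : ℝ)) * (pp.a₁ / c)))) * (((ℓ + 1 : ℕ) : ℝ)) ^ 6) * ((((ℓ + 1 : ℕ) : ℝ)) * ((1 + CLip d ℓ) * B9RWSums344Input.inputConst44 (B9RWSums347DefiniteFaces.exp261 (@geo9Y d ℓ hd hL b₀ b₁ (Mst)) pp.δ₀ pp.α) pp.δ₀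 pp.α pp.NI pp.N' (pp.C (B9RWSums347DefiniteFaces.exp261 (@geo9Y d ℓ hd hL b₀ b₁ (Mst)) pp.δ₀ pp.α)) (((ℓ + 1 : ℕ) : ℝ)) (pp.BI 0) (pp.θI 0) * ((((ℓ + 1 : ℕ) : ℝ)) * ((((ℓ + 1 : ℕ) : ℝ)) ^ 3 * (2 + 2 * coordBound39 (trBasis N) * basisBound39 (trBasis N) * (((ℓ + 1 : ℕ) : ℝ)) ^ 2)) * Real.exp ((1 - pp.αF) * ((1 - 2 * pp.α) * pp.δ₀) * (2 * (rNear d ℓ + 1) + (((d : ℝ) + 1) * (((ℓ : ℝ) + 1) + 1) + 2)))) * B6.c1 (B9RWSums347DefiniteFaces.exp261 (@geo9Y d ℓ hd hL b₀ b₁ (Mst)) pp.δ₀ pp.α) pp.δ₀ pp.α)) + coordBound39 (trBasis N) * basisBound39 (trBasis N) * ((((ℓ + 1 : ℕ) : ℝ)) * ((1 + CLip d ℓ) * B9RWSums344Input.inputConst44 (B9RWSums347DefiniteFaces.exp261 (@geo9Y d ℓ hd hL b₀ b₁ (Mst)) pp.δ₀ pp.α) pp.δ₀ pp.α pp.NI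 pp.N' (pp.C (B9RWSums347DefiniteFaces.exp261 (@geo9Y d ℓ hd hL b₀ b₁ (Mst)) pp.δ₀ pp.α)) (((ℓ + 1 : ℕ) : ℝ)) (pp.BI 0) (pp.θI 0) * ((((ℓ + 1 : ℕ) : ℝ)) * ((((ℓ + 1 : ℕ) : ℝ)) ^ 3 * (2 + 2 * coordBound39 (trBasis N) * basisBound39 (trBasis N) * (((ℓ + 1 : ℕ) : ℝ)) ^ 2)) * Real.exp ((1 - pp.αF) * ((1 - 2 * pp.α) * pp.δ₀) * (2 * (rNear d ℓ + 1) + (((d : ℝ) + 1) * (((ℓ : ℝ) + 1) + 1) + 2)))) * B6.c1 (B9RWSums347DefiniteFaces.exp261 (@geo9Y d ℓ hd hL b₀ b₁ (Mst)) pp.δ₀ pp.α) pp.δ₀ pp.α)) + ((((ℓ + 1 : ℕ) : ℝ)) * ((1 + CLip d ℓ) * B9RWSums344Input.inputConst44 (B9RWSums347DefiniteFaces.exp261 (@geo9Y d ℓ hd hL b₀ b₁ (Mst)) pp.δ₀ pp.α) pp.δ₀ pp.α pp.NI pp.N' (pp.C (B9RWSums347DefiniteFaces.exp261 (@geo9Y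 d ℓ hd hL b₀ b₁ (Mst)) pp.δ₀ pp.α)) (((ℓ + 1 : ℕ) : ℝ)) (pp.BI 0) (pp.θI 0) * ((((ℓ + 1 : ℕ) : ℝ)) * ((((ℓ + 1 : ℕ) : ℝ)) ^ 3 * (2 + 2 * coordBound39 (trBasis N) * basisBound39 (trBasis N) * (((ℓ + 1 : ℕ) : ℝ)) ^ 2)) * Real.exp ((1 - pp.αF) * ((1 - 2 * pp.α) * pp.δ₀) * (2 * (rNear d ℓ + 1) + (((d : ℝ) + 1) * (((ℓ : ℝ) + 1) + 1) + 2)))) * B6.c1 (B9RWSums347DefiniteFaces.exp261 (@geo9Y d ℓ hd hL b₀ b₁ (Mst)) pp.δ₀ pp.α) pp.δ₀ pp.α))) + ((((ℓ + 1 : ℕ) : ℝ)) * ((1 + CLip d ℓ) * B9RWSums344Input.inputConst44 (B9RWSums347DefiniteFaces.exp261 (@geo9Y d ℓ hd hL b₀ b₁ (Mst)) pp.δ₀ pp.α) pp.δ₀ pp.α pp.NI pp.N' (pp.C (B9RWSums347DefiniteFaces.exp261 (@geo9Y d ℓ hd hL b₀ b₁ (Mst)) pp.δ₀ pp.α)) (((ℓ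 + 1 : ℕ) : ℝ)) (pp.BI 0) (pp.θI 0) * ((((ℓ + 1 : ℕ) : ℝ)) * ((((ℓ + 1 : ℕ) : ℝ)) ^ 3 * (2 + 2 * coordBound39 (trBasis N) * basisBound39 (trBasis N) * (((ℓ + 1 : ℕ) : ℝ)) ^ 2)) * Real.exp ((1 - pp.αF) * ((1 - 2 * pp.α) * pp.δ₀) * (2 * (rNear d ℓ + 1) + (((d : ℝ) + 1) * (((ℓ : ℝ) + 1) + 1) + 2)))) * B6.c1 (B9RWSums347DefiniteFaces.exp261 (@geo9Y d ℓ hd hL b₀ b₁ (Mst)) pp.δ₀ pp.α) pp.δ₀ pp.α)) + coordBound39 (trBasis N) * basisBound39 (trBasis N) * ((((ℓ + 1 : ℕ) : ℝ)) * ((1 + CLip d ℓ) * B9RWSums344Input.inputConst44 (B9RWSums347DefiniteFaces.exp261 (@geo9Y d ℓ hd hL b₀ b₁ (Mst)) pp.δ₀ pp.α) pp.δ₀ pp.α pp.NI pp.N' (pp.C (B9RWSums347DefiniteFaces.exp261 (@geo9Y d ℓ hd hL b₀ b₁ (Mst)) pp.δ₀ pp.α)) (((ℓ + 1 : ℕ)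 : ℝ)) (pp.BI 0) (pp.θI 0) * ((((ℓ + 1 : ℕ) : ℝ)) * ((((ℓ + 1 : ℕ) : ℝ)) ^ 3 * (2 + 2 * coordBound39 (trBasis N) * basisBound39 (trBasis N) * (((ℓ + 1 : ℕ) : ℝ)) ^ 2)) * Real.exp ((1 - pp.αF) * ((1 - 2 * pp.α) * pp.δ₀) * (2 * (rNear d ℓ + 1) + (((d : ℝ) + 1) * (((ℓ : ℝ) + 1) + 1) + 2)))) * B6.c1 (B9RWSums347DefiniteFaces.exp261 (@geo9Y d ℓ hd hL b₀ b₁ (Mst)) pp.δ₀ pp.α) pp.δ₀ pp.α)))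
  let X107 : ℝ := (cR39 (trBasis N))⁻¹ * (((1 / 2 : ℝ))⁻¹ * max 0 K45W + max 0 KW * (CPw * (((ℓ + 1 : ℕ) : ℝ))) * (((1 / 2 : ℝ))⁻¹ * ((((ℓ + 1 : ℕ) : ℝ)) * Real.exp ((s / 16 - 1 / 1000 * (s / 16) - s / 4000) * (rNear d ℓ + 1)))) * rowConst261 (@geo9Y d ℓ hd hL b₀ b₁ (Mst)) (s / 4000) * rowConst261 (@geo9Y d ℓ hd hL b₀ b₁ (Mst)) (s / 4000))
  -- [«XK» (ii)] the (2.60) floor: `M12 := 1 + 2 log L ∕ (δ12₃ (2(ℓ+1)² − 1))` (`δ12₃ = s∕20`), its three facts packed in ONE ∧-hypothesis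
  obtain ⟨M12v, hM12⟩ : ∃ M : ℝ, (0 < M ∧ 1 ≤ M) ∧ (2 : ℝ) * Real.log (((ℓ + 1 : ℕ) : ℝ)) ≤ s / 20 * (2 * ((ℓ : ℝ) + 1) ^ 2 - 1) * M := by
    have hlogL : 0 ≤ Real.log (((ℓ + 1 : ℕ) : ℝ)) := Real.log_nonneg (by exact_mod_cast Nat.succ_le_succ (Nat.zero_le ℓ))
    have hℓ1 : (1 : ℝ) ≤ (ℓ : ℝ) + 1 := by have h0 : (0 : ℝ) ≤ (ℓ : ℝ) := Nat.cast_nonneg ℓ; linarith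
    have hL21 : (0 : ℝ) < 2 * ((ℓ : ℝ) + 1) ^ 2 - 1 := by have h1 : (1 : ℝ) ≤ ((ℓ : ℝ) + 1) ^ 2 := one_le_pow₀ hℓ1; linarith
    have hden : (0 : ℝ) < s / 20 * (2 * ((ℓ : ℝ) + 1) ^ 2 - 1) := mul_pos (by positivity) hL21
    have hq : 0 ≤ 2 * Real.log (((ℓ + 1 : ℕ) : ℝ)) / (s / 20 * (2 * ((ℓ : ℝ) + 1) ^ 2 - 1)) := div_nonneg (mul_nonneg zero_le_two hlogL) hden.le
    refine ⟨1 + 2 * Real.log (((ℓ + 1 : ℕ) : ℝ)) / (s / 20 * (2 * ((ℓ : ℝ) + 1) ^ 2 - 1)), ⟨by linarith, by linarith⟩, ?_⟩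
    rw [mul_add, mul_one, mul_comm (s / 20 * (2 * ((ℓ : ℝ) + 1) ^ 2 - 1)) (2 * Real.log (((ℓ + 1 : ℕ) : ℝ)) / _), div_mul_cancel₀ _ hden.ne']
    linarith
  refine ⟨1 / 2, s, s, max 1 B48, min 1 (c * a48 / c35Y), 1, 1, 1, pp, pp, ⟨0, 0, 0⟩, ⟨0, 0, 0⟩, ⟨W, BMx, θW ((((ℓ + 1 : ℕ) : ℝ)) ^ 2) * Real.exp ((3 / 4 + s) * 3) * (BRc * BMx)⟩, ⟨0, 0, 0⟩, 9 * s / 20, s / 50, s / 1000, s / 100, a12v, M12v,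
    max (max (max ((cR39 (trBasis N))⁻¹ * (((1 / 2 : ℝ))⁻¹ * max 0 K44G + (((d + 1 : ℕ) : ℝ) * pp.C (B9RWSums347DefiniteFaces.exp261 (@geo9Y d ℓ hd hL b₀ b₁ (Mst)) pp.δ₀ pp.α)) * (CPw * (((ℓ + 1 : ℕ) : ℝ))) * (((1 / 2 : ℝ))⁻¹ * ((((ℓ + 1 : ℕ) : ℝ)) * Real.exp ((s / 16 - 1 / 1000 * (s / 16) - s / 4000) * (rNear d ℓ + 1)))) * rowConst261 (@geo9Y d ℓ hd hL b₀ b₁ (Mst)) (s / 4000) * rowConst261 (@geo9Y d ℓ hd hL b₀ b₁ (Mst)) (s / 4000))) (K43 * (cR39 (trBasis N))⁻¹ * rowConst261 (@geo9Y d ℓ hd hL b₀ b₁ (Mst)) (s / 4000) + CTel d ℓ (trBasis N) (s / 20) (CPw * (((ℓ + 1 : ℕ) : ℝ)) * ((((d + 1 : ℕ) : ℝ) * pp.C (B9RWSums347DefiniteFaces.exp261 (@geo9Y d ℓ hd hL b₀ b₁ (Mst)) pp.δ₀ pp.α)) * (cR39 (trBasis N))⁻¹ * rowConst261 (@geo9Y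 d ℓ hd hL b₀ b₁ (Mst)) (s / 4000)) * rowConst261 (@geo9Y d ℓ hd hL b₀ b₁ (Mst)) (s / 4000)) (CPw * (((ℓ + 1 : ℕ) : ℝ)) * ((((d + 1 : ℕ) : ℝ) * pp.C (B9RWSums347DefiniteFaces.exp261 (@geo9Y d ℓ hd hL b₀ b₁ (Mst)) pp.δ₀ pp.α)) * (cR39 (trBasis N))⁻¹ * rowConst261 (@geo9Y d ℓ hd hL b₀ b₁ (Mst)) (s / 4000)) * rowConst261 (@geo9Y d ℓ hd hL b₀ b₁ (Mst)) (s / 4000)))) (max (((d : ℝ) + 1) * ((1 + CLip d ℓ) * max 0 K44m * (CJG d ℓ (trBasis N) (1 / 2) (thetaL d ℓ ϑFv) (1 / 2) (s / 20 + 1 + 1 / 2 * (s / 10 - s / 20)) * (((ℓ + 1 : ℕ) : ℝ))) * rowConst261 (@geo9Y d ℓ hd hL b₀ b₁ (Mst)) 1)) (((d : ℝ) + 1) * (1 * (((d : ℝ) + 1) * ((1 + CLip d ℓ) * max 0 K44m * (CJG d ℓ (trBasis N) (1 / 2) (thetaL d ℓ ϑFv) (1 / 2) (s / 20 + 1 +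 1 / 2 * (s / 10 - s / 20)) * (((ℓ + 1 : ℕ) : ℝ))) * rowConst261 (@geo9Y d ℓ hd hL b₀ b₁ (Mst)) 1)) * rowConst261 (@geo9Y d ℓ hd hL b₀ b₁ (Mst)) 1)))) 0,
    s / 20, s / 200, 1 / 8, s / 1000, fun _ => 0, 0, s / 20 + s / 200, s / 25, s / 1000, 0, fun _ => 0, fun _ => max 0 X107, 2 * ((d : ℝ) + 1) * (((ℓ + 1 : ℕ) : ℝ)) ^ 3 * (N : ℝ) * (10 ^ 4 * ((d : ℝ) + 1) * (max (10 * (((ℓ + 1 : ℕ) : ℝ)) ^ 7) aKv⁻¹)) * Real.exp (3 * s), s, s / 16, s / 16, fun _ => 0, fun _ => 0, 1, 1, 1, fun _ => 1 / 2, fun _ => 1 / 2, fun β => (1 + β) / 2, fun _ => max 0 K45, ϑFv, s / 10, s / 10, fun _ => max 0 K45, 1 / 1000, s / 4000, s / 16, s / 16, fun _ => max 0 K45W, s / 16, fun _ => max 0 KW, CPw, 1 / 2, s / 10, max 0 K44m, max 0 K44G, s / 16, 0, s / 20 + s / 4000, 0, s / 20, s / 20, 0, fun _ => 0, K43, s /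 2, s / 20, s / 4000, s / 40, max 0 ((1 / 2 : ℝ) * max 0 X107), 1, 2 * ((d : ℝ) + 1) + (rLB d ℓ + 1) + 1, pp.a₁ / c, 1, B0D, s / 4000, s / 100, κCv, s / 16 + 1, B36, αv, bv, 0,
    -- gen 28 «ZK₂»: δQs := δ12₀ + 1, CqK := 0; then `hpaK hqaK haIK ha12K ha1J htJ hδQs1 hδQs2 hδQs3 hCqK`, `q = p`, `haIR`
    9 * s / 20 + 1, 0,
    (div_le_iff₀ hc).2 (((min_le_right _ _).trans ((min_le_left _ _).trans (min_le_right _ _))).trans_eq (mul_comm _ _)), (div_le_iff₀ hc).2 (((min_le_right _ _).trans ((min_le_left _ _).trans (min_le_right _ _))).trans_eq (mul_comm _ _)), (div_le_iff₀ hc).2 (((min_le_right _ _).trans ((min_le_left _ _).trans (min_le_right _ _))).trans_eq (mul_comm _ _)),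
    by
      have h1 : (max (10 * (((ℓ + 1 : ℕ) : ℝ)) ^ 7) aKv⁻¹) * a12v ≤ 1 := ((mul_le_mul_of_nonneg_left ha12v1 hcJ).trans (by rw [mul_one_div]; exact div_le_one_of_le₀ (by linarith) (by positivity)))
      have h2 := mul_le_mul_of_nonneg_left ((mul_le_mul_of_nonneg_right (le_max_right _ _) ha12v0.le).trans h1) haK.le
      rwa [mul_inv_cancel_left₀ haK.ne', mul_one] at h2,
    by
      have h1 : (max (10 * (((ℓ + 1 : ℕ) : ℝ)) ^ 7) aKv⁻¹) * a12v ≤ 1 := ((mul_le_mul_of_nonneg_left ha12v1 hcJ).trans (by rw [mul_one_div]; exact div_le_one_of_le₀ (by linarith) (by positivity)))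
      exact (mul_le_mul_of_nonneg_right (le_max_left _ _) ha12v0.le).trans h1,
    by gcongr; exact le_max_left _ _, le_rfl, by linarith, by linarith, le_rfl, rfl, le_rfl,
    (div_le_iff₀ hc).2 ((((min_le_right _ _).trans (min_le_right _ _)).trans (min_le_right _ _)).trans_eq (mul_comm _ _)),
    (mul_le_mul_of_nonneg_left (min_le_right _ _) c35Y_pos.le).trans_eq (mul_div_cancel₀ _ c35Y_pos.ne'), le_max_right _ _, hs48,
    ((le_max_right _ _).trans (le_max_right _ _)).trans (le_max_right _ _), le_rfl, hs36,
     by norm_num, by norm_num, hs, le_rfl, lt_of_lt_of_le one_pos (le_max_left _ _), lt_min one_pos (div_pos (mul_pos hc ha48) c35Y_pos), by norm_num, by norm_num, by norm_num, hpp, hpp, ⟨le_rfl, le_rfl, le_rfl⟩, ⟨le_rfl, le_rfl, le_rfl⟩, ⟨hW, hBMx.le, by have := hθW ((((ℓ + 1 : ℕ) : ℝ)) ^ 2) (by positivity); positivity⟩, ⟨le_rfl, le_rfl, le_rfl⟩, hMfl.1.1.1.1, hMfl.1.1.1.2, hMfl.1.1.2, hMfl.2, by positivity, by linarith, by linarith,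 fun _ => le_rfl, le_max_right _ _, by positivity, by positivity, by linarith, by linarith, by linarith, ha12v0, hM12.1.1, by norm_num, by norm_num, by linarith, ?_, le_rfl, by positivity, by linarith, by linarith, ?_, hM12.1.2, hM12.2, ha12v1.trans (div_le_one_of_le₀ (by linarith) (by positivity)), by linarith, by positivity, by linarith, by linarith, le_rfl, fun _ _ _ => le_rfl, fun _ _ _ => le_max_left _ _, hcJ, ((mul_le_mul_of_nonneg_left ha12v1 hcJ).trans (by rw [mul_one_div]; exact div_le_one_of_le₀ (by linarith) (by positivity))), le_rfl, ?_, by linarith, by positivity, ?_, fun _ _ _ => le_rfl, fun _ _ _ => le_rfl, by norm_num, by norm_num, by norm_num, by linarith, le_rfl, ?_, (le_max_left _ _).trans (le_max_right _ _), (min_le_right _ _).trans (min_le_left _ _), le_rfl, hsM, ((le_max_left _ _).trans (le_max_right _ _)).trans (le_max_right _ _), ((min_le_right _ _).trans (min_le_right _ _)).trans (min_le_left _ _), hsR, le_rfl, le_rfl, le_rfl, le_rfl, le_rfl, le_rfl, le_rfl, le_rfl, fun _ => by norm_num, fun _ => by norm_num, fun _ => by norm_num, fun _ => by norm_num, fun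 _ h0 _ => by linarith, fun _ _ h1 => by linarith, fun _ _ _ => by norm_num, le_rfl, by linarith, fun _ _ _ => le_max_left _ _, by linarith, fun _ _ _ => le_max_left _ _, by norm_num, by norm_num, by positivity, by positivity, ?_, by nlinarith, by nlinarith, fun _ _ _ => by norm_num, by nlinarith, fun _ _ _ => le_max_left _ _, by nlinarith, fun _ _ _ => le_max_left _ _, le_rfl, fun _ _ _ => le_max_right _ _, by norm_num, by norm_num, by norm_num, by linarith, le_max_left _ _,
    ((le_max_left _ _).trans (le_max_right _ _)).trans (le_max_left _ _), ((le_max_right _ _).trans (le_max_right _ _)).trans (le_max_left _ _), by norm_num, le_max_left _ _, by linarith, ((le_max_left _ _).trans (le_max_left _ _)).trans (le_max_left _ _), le_rfl, fun _ _ _ => le_rfl, le_rfl, le_rfl, by positivity, le_rfl, le_rfl, by simp, fun s _ _ => by rw [show pp.NH = (0 : ℝ) from rfl, show pp.NF = (0 : ℝ) from rfl]; simp [B9RWSums343Holder.holderConst], by simp, le_rfl, by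
      have h1 := PinPrims.C_nonneg hpp (B9RWSums347DefiniteFaces.exp261 (@geo9Y d ℓ hd hL b₀ b₁ (Mst)) pp.δ₀ pp.α)
      have h2 : (0 : ℝ) ≤ B0D := le_max_left _ _
      positivity, by positivity, by nlinarith, by linarith, le_rfl, ((le_max_right _ _).trans (le_max_left _ _)).trans (le_max_left _ _), by positivity, le_max_left _ _, fun _ _ _ => le_max_right _ _, by linarith, ?_, ?_, by linarith, by linarith, by linarith, by linarith, by linarith, by linarith, by linarith, by linarith, by linarith, by linarith, zero_le_one, ?_, div_pos hpp.a₁_pos hc, by norm_num, ?_, ?_, le_max_left _ _, fun _ _ _ => le_max_right _ _, le_rfl, by rw [hα, hδ]; linarith, fun _ _ _ => le_max_right _ _, by rw [hα, hδ]; linarith, by rw [hα, hF]; norm_num, fun _ _ h1 => by linarith, le_max_right _ _, by rw [hα, hF, hδ]; nlinarith [hs], fun _ _ _ => le_max_right _ _, by rw [hα, hF, hδ]; nlinarith [hs], fun _ _ _ => le_max_right _ _, by rw [hα, hF, hδ]; nlinarith [hs], le_max_right _ _, by rw [hα, hF, hδ]; nlinarith [hs], fun _ _ _ => le_max_right _ _,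 by rw [hα, hF, hδ]; nlinarith [hs], by rw [hα, hF, hδ]; nlinarith [hs], by positivity, by rw [hα, hδ]; linarith [hs], by rw [hα, hδ, min_eq_left (by linarith [hs])]; linarith [hs], by linarith [hs], by linarith [hs], by linarith [hs], by linarith [hs], by linarith [hs], by linarith [hs], by linarith [hs], by linarith [hs], by linarith [hs], by positivity, by linarith [hs], by linarith [hs], hκC0, by linarith [hs], hB36, hMfl.1.2, hB0ge36, hKa, hα3, hα4, hbb, hsmall, hc₃, h145, h155, hκ2, by positivity, le_rfl, by rw [mul_zero, mul_zero]; exact le_trans zero_le_one (le_max_left _ _),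
    le_rfl, le_rfl, le_rfl, le_rfl, le_rfl⟩
  · rw [hF, hα, hδ]; linarith
  · rw [hF, hα, hδ]; linarith
  · rw [hα, hδ, min_eq_left (by linarith)]; linarith
  · rw [hF, hα, hδ]; linarith
  · rw [hF]; linarith
  · rw [hα, hδ, min_eq_left (by linarith)]; linarith
  · rw [hα, hδ]; linarith
  · rw [hα, hδ, min_eq_left (by linarith)]; linarith
  · have h := rLB_nonneg d ℓ; have hd0 : (0 : ℝ) ≤ d := Nat.cast_nonneg d; linarith
  · have h := rLB_nonneg d ℓ; linarith
  · have hd0 : (0 : ℝ) ≤ d := Nat.cast_nonneg d; linarith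

end Summit.QuantumFields.YangMills.BalabanUVNodes.N06NumericsWitnessZK7

end
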